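import Literature.NumberTheory.LFunctions.BondarenkoHeap2026DiagonalProofs
import Literature.NumberTheory.LFunctions.BondarenkoHeap2026Section6Proofs
import Literature.NumberTheory.LFunctions.BondarenkoHeap2026CompleteSumsProofs
import HarnessLib

/-!
# Bondarenko–Heap 2026: the off-diagonal of `I₀` and Theorem 3

LABEL (C5 / rh-crit-ah, LADDER-RH §4 HELD «conditional bridges: exceptional zero ⇒ …»):
**NOT RH-BEARING.** RH-FREE literature (arXiv:2608.07399v1, §4 p. 12): finite character-sum and
real-analysis estimates; no `ζ` zeros, no `RiemannHypothesis` binder except inside the quoted apex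
`bondarenkoHeap2026_theorem1`; nothing here bears on the truth of RH. Companion of
`BondarenkoHeap2026DiagonalProofs` (t2: (15), the diagonal, `theorem3_of_offDiagonal`).

PROVED here (theorems only; no named fact is introduced):

* `theorem3_holds : theorem3` — **Bondarenko–Heap Theorem 3** ("`I₀ = (1 + o(1)) D_G Ŵ_T(0)(φ(q)/q) log L`"),
  by `theorem3_of_offDiagonal` and the off-diagonal estimate `offDiagI0_le_eventually`:
  `|offDiagI0| ≤ η S(q)` eventually, `S(q) = Ŵ_T(0)(φ(q)/q) log L`.
* The printed argument (§4 p. 12: "For the off-diagonals, put `n = m + r` … from the support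
  conditions of `Ŵ` we may restrict `|r| ≪_Φ M/T`. Then, Lemma 4 gives, for one block, …
  `≪ q^ε(M/q + √q)` after using (16) … the off-diagonal is `≪ q^ε(L/q + √q log(2L)) = o(T)`") is
  followed with ONE deviation, recorded here: instead of a smooth dyadic partition of unity and the
  `C^∞`/`‖·‖_BV` form of Lemma 4, the completion lemma is used in its DISCRETE form
  `discreteCompletion_of_eq14` — (13) (`completion_identity_split`) + (14) (`eq14_holds`, t4) + partial
  summation against the geometric sums (`norm_sum_mul_le_of_partial_sums`, `norm_sum_stdAddChar_le`,
  `sum_erase_zero_inv_norm_stdAddChar_sub_one_le`, t2), i.e. for ANY `f : ℕ → ℂ`,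
  `|∑_{m≤N} f(m)χ(m)χ(km+r)| ≤ C q^ε {((r,Q)/q)∑|f(m)| + √(q(r,Q))(|f(N)| + ∑|f(i+2) − f(i+1)|)}`.
  The weight `f_r(m) = G(m)G(m+r)/√(m(m+r)) Ŵ_T(log(1+r/m)/2π)` then needs only: `|Ŵ_T| ≤ K T`
  (`abs_weightHat_le_integral`, `integral_weight_le`), the Lipschitz bound
  `|Ŵ_T(ξ) − Ŵ_T(ξ′)| ≤ K T²|ξ − ξ′|` (`abs_weightHat_sub_le`, `integral_abs_mul_weight_le`), the
  support (2) (`weightHat_support_holds`, t1) in the form `weightHat_shift_eq_zero` (terms with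
  `8πσ m < rT` vanish), `|G| ≤ M_G` (`exists_G_bound`, t2) and `|G(n+1) − G(n)| ≤ D_a/n + D_b/L`
  (`exists_G_diff_bound`, mean value theorem for `G₀.eval` and `f₀` on `[0,2]`); the discrete variation
  of `f_r` is `O(1) + O(T log L/L)` uniformly (`shiftWeight_variation_le`), its `ℓ¹` norm is
  `≤ M_G² K T (1 + log L)`; summing `r ≤ 8πσL/T` with `∑_{r≤R}(r,Q) ≤ R d(Q)` (`gcd_sum_le`, t2) and
  `d(Q) ≪ q^{1/16}` gives `|offDiagI0| ≤ Const · q^{97/48}`, against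
  `η S(q) ≥ η (C_Φ/2Cφ) q^{109/48}` (`weightHat_zero_lower`, `cPhi_pos_holds`, `q/φ(q) ≪ q^{1/16}`).
* Bookkeeping corollary `bondarenkoHeap2026_theorem1_of_prop1_prop3_prop6 : proposition1 → prop3 →
  prop6 → bondarenkoHeap2026_theorem1`.

## References

* [BondarenkoHeap2026] A. Bondarenko, W. Heap, arXiv:2608.07399v1: Theorem 3 (§2.3 (6) p. 8) and its
  proof, §4 pp. 11–12 (TeX ll. 583–612); Lemma 4 ((12)–(14)) §4 p. 10; (16) p. 12; (2)–(3) §2.1 p. 5.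
-/

noncomputable section

open Finset Real Complex MeasureTheory

namespace Literature.NumberTheory.LFunctions.BondarenkoHeap2026



section DiscreteCompletion

/-- `1 + log q ≤ (1 + 2/ε) q^{ε/2}` for `q ≥ 1`. [folklore] -/
private theorem one_add_log_le_rpow {q : ℝ} (hq : 1 ≤ q) {ε : ℝ} (hε : 0 < ε) :
    1 + Real.log q ≤ (1 + 2 / ε) * q ^ (ε / 2) := by
  have hq0 : 0 ≤ q := by linarith
  have h1 : Real.log q ≤ q ^ (ε / 2) / (ε / 2) := Real.log_le_rpow_div hq0 (by positivity)
  have h2 : (1 : ℝ) ≤ q ^ (ε / 2) := Real.one_le_rpow hq (by positivity)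
  calc 1 + Real.log q ≤ q ^ (ε / 2) + q ^ (ε / 2) / (ε / 2) := add_le_add h2 h1
    _ = (1 + 2 / ε) * q ^ (ε / 2) := by field_simp

/-- `(r, b, Q) ≤ (r, Q)` for the gcds of (14) (`Q ≠ 0`). [folklore] -/
private theorem gcd_gcd_le_gcd' (r : ℤ) (b : ℕ) {Q : ℕ} (hQ : Q ≠ 0) :
    Int.gcd (Int.gcd r b : ℤ) Q ≤ Int.gcd r Q := by
  have h1 : ((Int.gcd (Int.gcd r b : ℤ) Q : ℕ) : ℤ) ∣ r :=
    (Int.gcd_dvd_left _ _).trans (Int.gcd_dvd_left _ _)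
  have h2 : ((Int.gcd (Int.gcd r b : ℤ) Q : ℕ) : ℤ) ∣ (Q : ℤ) := Int.gcd_dvd_right _ _
  have h3 : ((Int.gcd (Int.gcd r b : ℤ) Q : ℕ) : ℤ) ∣ (Int.gcd r Q : ℤ) := Int.dvd_coe_gcd h1 h2
  have h4 : Int.gcd (Int.gcd r b : ℤ) Q ∣ Int.gcd r Q := by exact_mod_cast h3
  have hpos : 0 < Int.gcd r Q := Int.gcd_pos_of_ne_zero_right _ (by exact_mod_cast hQ)
  exact Nat.le_of_dvd hpos h4

/-- **Discrete completion lemma** — the content of the proof of Lemma 4 ((13) `completion_identity`,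
(14), and partial summation against the geometric sums `∑_j e(bj/q) ≪ ‖b/q‖⁻¹`), with the weight's
regularity entering ONLY through its discrete total variation (no smoothness, no dyadic window):
assuming (14), for every `ε > 0` there is `C` such that for `χ` the primitive quadratic character
mod `q = 2^ν Q` (`Q` odd), nonzero `k, r`, every `N` and every `f : ℕ → ℂ`,
`|∑_{1≤m≤N} f(m)χ(m)χ(km + r)| ≤ C q^ε {((r,Q)/q) ∑_{m≤N} |f(m)| + √(q(r,Q)) (|f(N)| + ∑_{i<N−1} |f(i+2) − f(i+1)|)}`.
[cite: BondarenkoHeap2026, Lemma 4 (proof, (12)–(14)), §4 p. 10] -/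
theorem discreteCompletion_of_eq14 (h14 : eq14) {ε : ℝ} (hε : 0 < ε) :
    ∃ C : ℝ, 0 < C ∧ ∀ (q : ℕ) [NeZero q] (χ : DirichletCharacter ℂ q), χ.IsPrimitive →
      χ.IsQuadratic → ∀ ν Q : ℕ, q = 2 ^ ν * Q → Odd Q → ∀ k r : ℤ, k ≠ 0 → r ≠ 0 →
      ∀ (N : ℕ) (f : ℕ → ℂ),
        ‖∑ m ∈ Icc 1 N, f m * χ (m : ZMod q) * χ ((k * m + r : ℤ) : ZMod q)‖ ≤
          C * (q : ℝ) ^ ε * ((Int.gcd r Q : ℝ) / q * ∑ m ∈ Icc 1 N, ‖f m‖ +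
            Real.sqrt (q * Int.gcd r Q) *
              (‖f N‖ + ∑ i ∈ Finset.range (N - 1), ‖f (i + 2) - f (i + 1)‖)) := by
  obtain ⟨C₁, hC₁, h14'⟩ := h14 (ε / 2) (by positivity)
  refine ⟨C₁ * (1 + 2 / ε), by positivity, ?_⟩
  intro q _ χ hprim hquad ν Q hq hQodd k r hk hr N f
  classical
  obtain ⟨h0, hb⟩ := h14' q χ hprim hquad ν Q hq hQodd k r hk hr
  have hQ0 : Q ≠ 0 := by rintro rfl; exact (Nat.not_odd_zero hQodd).elim
  have hq0 : (0 : ℝ) < q := by exact_mod_cast Nat.pos_of_ne_zero (NeZero.ne q)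
  have hq1 : (1 : ℝ) ≤ q := by exact_mod_cast Nat.pos_of_ne_zero (NeZero.ne q)
  set g : ℕ := Int.gcd r Q with hg
  set TV : ℝ := ‖f N‖ + ∑ i ∈ Finset.range (N - 1), ‖f (i + 2) - f (i + 1)‖ with hTV
  have hTV0 : 0 ≤ TV := by positivity
  set L1 : ℝ := ∑ m ∈ Icc 1 N, ‖f m‖ with hL1
  have hL10 : 0 ≤ L1 := by positivity
  -- (13)
  rw [completion_identity_split χ k r (Icc 1 N) f]
  -- Term 1: `b = 0`
  have hT1 : ‖twistedShiftSum χ k r 0 / q * ∑ n ∈ Icc 1 N, f n‖ ≤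
      C₁ * (q : ℝ) ^ ε * ((g : ℝ) / q * L1) := by
    have hsum : ‖∑ n ∈ Icc 1 N, f n‖ ≤ L1 := norm_sum_le _ _
    rw [norm_mul, norm_div, Complex.norm_natCast]
    calc ‖twistedShiftSum χ k r 0‖ / q * ‖∑ n ∈ Icc 1 N, f n‖
        ≤ (C₁ * (q : ℝ) ^ (ε / 2) * g) / q * L1 := by gcongr
      _ = C₁ * (q : ℝ) ^ (ε / 2) * ((g : ℝ) / q * L1) := by ring
      _ ≤ C₁ * (q : ℝ) ^ ε * ((g : ℝ) / q * L1) := by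
          have : (q : ℝ) ^ (ε / 2) ≤ (q : ℝ) ^ ε :=
            Real.rpow_le_rpow_of_exponent_le hq1 (by linarith)
          have h' : 0 ≤ (g : ℝ) / q * L1 := by positivity
          gcongr
  -- Term 2: each `W_b`, by partial summation
  have hW : ∀ b : ZMod q, b ≠ 0 →
      ‖∑ n ∈ Icc 1 N, f n * ZMod.stdAddChar (b * (n : ZMod q))‖ ≤
        2 / ‖ZMod.stdAddChar b - 1‖ * TV := by
    intro b hb0
    have hre : ∑ n ∈ Icc 1 N, f n * ZMod.stdAddChar (b * (n : ZMod q)) =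
        ∑ i ∈ Finset.range N, f (i + 1) * ZMod.stdAddChar (b * ((i + 1 : ℕ) : ZMod q)) := by
      rw [← Finset.Ico_add_one_right_eq_Icc, Finset.sum_Ico_eq_sum_range]
      simp only [Nat.add_sub_cancel]
      refine Finset.sum_congr rfl fun i _ => ?_
      rw [add_comm 1 i]
    rw [hre]
    have hB : ∀ m ≤ N, ‖∑ j ∈ Finset.range m, ZMod.stdAddChar (b * ((j + 1 : ℕ) : ZMod q))‖ ≤
        2 / ‖ZMod.stdAddChar b - 1‖ := fun m _ => norm_sum_stdAddChar_le hb0 m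
    exact norm_sum_mul_le_of_partial_sums f _ N hB
  -- Term 2 total
  have hT2 : ‖(1 / (q : ℂ)) * ∑ b ∈ (Finset.univ : Finset (ZMod q)).erase 0,
      twistedShiftSum χ k r b * ∑ n ∈ Icc 1 N, f n * ZMod.stdAddChar (b * (n : ZMod q))‖ ≤
      C₁ * (1 + 2 / ε) * (q : ℝ) ^ ε * (Real.sqrt (q * g) * TV) := by
    have hsqg : ∀ b : ZMod q, Real.sqrt (Int.gcd (Int.gcd r b.val : ℤ) Q) ≤ Real.sqrt g :=
      fun b => Real.sqrt_le_sqrt (by exact_mod_cast gcd_gcd_le_gcd' r b.val hQ0)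
    have hterm : ∀ b ∈ (Finset.univ : Finset (ZMod q)).erase 0,
        ‖twistedShiftSum χ k r b * ∑ n ∈ Icc 1 N, f n * ZMod.stdAddChar (b * (n : ZMod q))‖ ≤
          (C₁ * (q : ℝ) ^ (1 / 2 + ε / 2) * Real.sqrt g * (2 * TV)) *
            (1 / ‖ZMod.stdAddChar b - 1‖) := by
      intro b hbmem
      have hb0 : b ≠ 0 := (Finset.mem_erase.mp hbmem).1
      rw [norm_mul]
      have hBb : 0 ≤ 2 / ‖ZMod.stdAddChar b - 1‖ * TV := by positivity
      calc ‖twistedShiftSum χ k r b‖ * ‖∑ n ∈ Icc 1 N, f n * ZMod.stdAddChar (b * (n : ZMod q))‖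
          ≤ (C₁ * (q : ℝ) ^ (1 / 2 + ε / 2) * Real.sqrt (Int.gcd (Int.gcd r b.val : ℤ) Q)) *
              (2 / ‖ZMod.stdAddChar b - 1‖ * TV) :=
            mul_le_mul (hb b hb0) (hW b hb0) (norm_nonneg _) (by positivity)
        _ ≤ (C₁ * (q : ℝ) ^ (1 / 2 + ε / 2) * Real.sqrt g) * (2 / ‖ZMod.stdAddChar b - 1‖ * TV) :=
            mul_le_mul_of_nonneg_right (mul_le_mul_of_nonneg_left (hsqg b) (by positivity)) hBb
        _ = (C₁ * (q : ℝ) ^ (1 / 2 + ε / 2) * Real.sqrt g * (2 * TV)) *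
              (1 / ‖ZMod.stdAddChar b - 1‖) := by ring
    have hlog : 1 + Real.log q ≤ (1 + 2 / ε) * (q : ℝ) ^ (ε / 2) := one_add_log_le_rpow hq1 hε
    rw [norm_mul, norm_div, norm_one, Complex.norm_natCast]
    calc 1 / (q : ℝ) * ‖∑ b ∈ (Finset.univ : Finset (ZMod q)).erase 0,
          twistedShiftSum χ k r b * ∑ n ∈ Icc 1 N, f n * ZMod.stdAddChar (b * (n : ZMod q))‖
        ≤ 1 / (q : ℝ) * ∑ b ∈ (Finset.univ : Finset (ZMod q)).erase 0,
          ‖twistedShiftSum χ k r b * ∑ n ∈ Icc 1 N, f n * ZMod.stdAddChar (b * (n : ZMod q))‖ := by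
          gcongr; exact norm_sum_le _ _
      _ ≤ 1 / (q : ℝ) * ∑ b ∈ (Finset.univ : Finset (ZMod q)).erase 0,
          (C₁ * (q : ℝ) ^ (1 / 2 + ε / 2) * Real.sqrt g * (2 * TV)) *
            (1 / ‖ZMod.stdAddChar b - 1‖) := by
          gcongr with b hb'
          exact hterm b hb'
      _ = 1 / (q : ℝ) * ((C₁ * (q : ℝ) ^ (1 / 2 + ε / 2) * Real.sqrt g * (2 * TV)) *
          ∑ b ∈ (Finset.univ : Finset (ZMod q)).erase 0, 1 / ‖ZMod.stdAddChar b - 1‖) := by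
          rw [← Finset.mul_sum]
      _ ≤ 1 / (q : ℝ) * ((C₁ * (q : ℝ) ^ (1 / 2 + ε / 2) * Real.sqrt g * (2 * TV)) *
          ((q : ℝ) / 2 * (1 + Real.log q))) := by
          gcongr; exact sum_erase_zero_inv_norm_stdAddChar_sub_one_le q
      _ = C₁ * (q : ℝ) ^ (1 / 2 + ε / 2) * Real.sqrt g * TV * (1 + Real.log q) := by
          field_simp
      _ ≤ C₁ * (q : ℝ) ^ (1 / 2 + ε / 2) * Real.sqrt g * TV *
          ((1 + 2 / ε) * (q : ℝ) ^ (ε / 2)) := by gcongr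
      _ = C₁ * (1 + 2 / ε) * ((q : ℝ) ^ (1 / 2 + ε / 2) * (q : ℝ) ^ (ε / 2)) *
          Real.sqrt g * TV := by ring
      _ = C₁ * (1 + 2 / ε) * ((q : ℝ) ^ ε * Real.sqrt q) * Real.sqrt g * TV := by
          congr 2
          rw [← Real.rpow_add hq0, Real.sqrt_eq_rpow, ← Real.rpow_add hq0]
          ring_nf
      _ = C₁ * (1 + 2 / ε) * (q : ℝ) ^ ε * (Real.sqrt (q * g) * TV) := by
          rw [Real.sqrt_mul hq0.le]; ring
  -- assemble
  have hC1le : C₁ ≤ C₁ * (1 + 2 / ε) := by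
    have : (1 : ℝ) ≤ 1 + 2 / ε := by have := div_pos two_pos hε; linarith
    nlinarith
  calc ‖twistedShiftSum χ k r 0 / q * ∑ n ∈ Icc 1 N, f n +
        (1 / (q : ℂ)) * ∑ b ∈ (Finset.univ : Finset (ZMod q)).erase 0,
          twistedShiftSum χ k r b * ∑ n ∈ Icc 1 N, f n * ZMod.stdAddChar (b * (n : ZMod q))‖
      ≤ C₁ * (q : ℝ) ^ ε * ((g : ℝ) / q * L1) +
          C₁ * (1 + 2 / ε) * (q : ℝ) ^ ε * (Real.sqrt (q * g) * TV) :=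
        (norm_add_le _ _).trans (add_le_add hT1 hT2)
    _ ≤ C₁ * (1 + 2 / ε) * (q : ℝ) ^ ε * ((g : ℝ) / q * L1) +
          C₁ * (1 + 2 / ε) * (q : ℝ) ^ ε * (Real.sqrt (q * g) * TV) := by
        have h' : 0 ≤ (q : ℝ) ^ ε * ((g : ℝ) / q * L1) := by positivity
        nlinarith
    _ = C₁ * (1 + 2 / ε) * (q : ℝ) ^ ε * ((g : ℝ) / q * L1 + Real.sqrt (q * g) * TV) := by ring

end DiscreteCompletion


section WeightHatBounds

/-- `W_T(t) ≤ W_1(t/T)` for `T ≥ 1` (the polynomial prefactor only grows). [cite: BondarenkoHeap2026, §2.1 (1) p. 5] -/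
private theorem weight_le_weight_one (w : Bump) (B : ℕ) {T : ℝ} (hT : 1 ≤ T) (t : ℝ) :
    weight w B T t ≤ weight w B 1 (t / T) := by
  unfold weight
  have hT0 : 0 < T := by linarith
  have hg : 0 ≤ Phi w (t / T - 1) ^ 2 + Phi w (t / T + 1) ^ 2 := by positivity
  simp only [one_pow, div_one]
  refine mul_le_mul_of_nonneg_right ?_ hg
  refine pow_le_pow_left₀ (by positivity) ?_ B
  rw [div_le_iff₀ (by positivity)]
  have h1 : (t / T) ^ 2 * T ^ 2 = t ^ 2 := by field_simp
  have h2 : (1 : ℝ) ≤ T ^ 2 := by nlinarith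
  nlinarith

/-- `∫ W_T ≤ T ∫ W_1` for `T ≥ 1`. [cite: BondarenkoHeap2026, §2.1 (3) p. 5 (`Ŵ_T(0) ≍ T`)] -/
theorem integral_weight_le (w : Bump) (B : ℕ) {T : ℝ} (hT : 1 ≤ T) :
    ∫ t, weight w B T t ≤ T * ∫ t, weight w B 1 t := by
  have hT0 : 0 < T := by linarith
  have h1 : ∫ t, weight w B T t ≤ ∫ t, (fun x => weight w B 1 x) (t / T) := by
    refine integral_mono (Extension.integrable_weight w B hT0) ?_
      (fun t => weight_le_weight_one w B hT t)
    exact (Extension.integrable_weight w B one_pos).comp_div hT0.ne'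
  rw [Measure.integral_comp_div, abs_of_pos hT0, smul_eq_mul] at h1
  exact h1

/-- `∫ |t| W_T(t) ≤ T² ∫ |t| W_1(t)` for `T ≥ 1`. [cite: BondarenkoHeap2026, §2.1 (1) p. 5] -/
theorem integral_abs_mul_weight_le (w : Bump) (B : ℕ) {T : ℝ} (hT : 1 ≤ T) :
    ∫ t, |t| * weight w B T t ≤ T ^ 2 * ∫ t, |t| * weight w B 1 t := by
  have hT0 : 0 < T := by linarith
  have h1 : ∫ t, |t| * weight w B T t ≤
      ∫ t, (fun x : ℝ => T * (|x| * weight w B 1 x)) (t / T) := by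
    refine integral_mono (Extension.integrable_abs_mul_weight w B hT0) ?_ (fun t => ?_)
    · exact ((Extension.integrable_abs_mul_weight w B one_pos).const_mul T).comp_div hT0.ne'
    · simp only
      rw [abs_div, abs_of_pos hT0, ← mul_assoc, mul_div_cancel₀ _ hT0.ne']
      exact mul_le_mul_of_nonneg_left (weight_le_weight_one w B hT t) (abs_nonneg t)
  have h2 := Measure.integral_comp_div (fun x : ℝ => T * (|x| * weight w B 1 x)) T
  rw [h2, abs_of_pos hT0, smul_eq_mul, integral_const_mul] at h1
  calc ∫ t, |t| * weight w B T t ≤ T * (T * ∫ t, |t| * weight w B 1 t) := h1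
    _ = T ^ 2 * ∫ t, |t| * weight w B 1 t := by ring

/-- `|Ŵ_T(ξ)| ≤ ∫ W_T` ("`Ŵ_T ≪_Φ T`", §4 p. 12). [cite: BondarenkoHeap2026, §4 p. 12 (proof of Theorem 3)] -/
theorem abs_weightHat_le_integral (w : Bump) (B : ℕ) (T : ℝ) (ξ : ℝ) :
    |weightHat w B T ξ| ≤ ∫ t, weight w B T t := by
  rw [weightHat, Real.fourier_real_eq_integral_exp_smul]
  refine (Complex.abs_re_le_norm _).trans ((norm_integral_le_integral_norm _).trans (le_of_eq ?_))
  refine integral_congr_ae (Filter.Eventually.of_forall fun t => ?_)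
  simp only [smul_eq_mul, norm_mul, Complex.norm_exp_ofReal_mul_I, one_mul, Complex.norm_real,
    Real.norm_eq_abs, abs_of_nonneg (weight_nonneg w B T t)]

/-- `‖e^{ia} − e^{ib}‖ ≤ |a − b|` for real `a, b`. [folklore] -/
private theorem norm_cexp_I_sub_cexp_I_le (a b : ℝ) :
    ‖Complex.exp ((a : ℂ) * Complex.I) - Complex.exp ((b : ℂ) * Complex.I)‖ ≤ |a - b| := by
  have h1 : Complex.exp ((a : ℂ) * Complex.I) - Complex.exp ((b : ℂ) * Complex.I) =
      Complex.exp ((b : ℂ) * Complex.I) * (Complex.exp (Complex.I * ((a - b : ℝ) : ℂ)) - 1) := by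
    rw [mul_sub, mul_one, ← Complex.exp_add]
    congr 2; push_cast; ring
  rw [h1, norm_mul, Complex.norm_exp_ofReal_mul_I, one_mul, Complex.norm_exp_I_mul_ofReal_sub_one,
    Real.norm_eq_abs, abs_mul, abs_two]
  have := Real.abs_sin_le_abs (x := (a - b) / 2)
  have h2 : |(a - b) / 2| = |a - b| / 2 := by rw [abs_div, abs_two]
  linarith

/-- **`Ŵ_T` is Lipschitz**: `|Ŵ_T(ξ) − Ŵ_T(ξ′)| ≤ 2π|ξ − ξ′| ∫ |t| W_T(t)`. [cite: BondarenkoHeap2026, §4 p. 12 ("`‖V‖_BV ≪ 1` since `Ŵ_T ≪_Φ T`")] -/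
theorem abs_weightHat_sub_le (w : Bump) (B : ℕ) {T : ℝ} (hT : 0 < T) (ξ ξ' : ℝ) :
    |weightHat w B T ξ - weightHat w B T ξ'| ≤
      2 * π * |ξ - ξ'| * ∫ t, |t| * weight w B T t := by
  have hWi : Integrable (fun v : ℝ => ((weight w B T v : ℝ) : ℂ)) :=
    (Extension.integrable_weight w B hT).ofReal
  have hi : ∀ η : ℝ, Integrable (fun v : ℝ =>
      Complex.exp (((-2 * π * v * η : ℝ) : ℂ) * Complex.I) * ((weight w B T v : ℝ) : ℂ)) := by
    intro η
    refine hWi.bdd_mul (c := 1) (Continuous.aestronglyMeasurable (by fun_prop)) ?_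
    exact Filter.Eventually.of_forall fun v => by rw [Complex.norm_exp_ofReal_mul_I]
  rw [weightHat, weightHat, Real.fourier_real_eq_integral_exp_smul,
    Real.fourier_real_eq_integral_exp_smul]
  simp only [smul_eq_mul]
  rw [← Complex.sub_re, ← integral_sub (hi ξ) (hi ξ')]
  refine (Complex.abs_re_le_norm _).trans ((norm_integral_le_integral_norm _).trans ?_)
  rw [← integral_const_mul]
  refine integral_mono_of_nonneg (Filter.Eventually.of_forall fun v => norm_nonneg _)
    ((Extension.integrable_abs_mul_weight w B hT).const_mul _)
    (Filter.Eventually.of_forall fun v => ?_)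
  simp only
  rw [← sub_mul, norm_mul, Complex.norm_real, Real.norm_eq_abs,
    abs_of_nonneg (weight_nonneg w B T v)]
  have h := norm_cexp_I_sub_cexp_I_le (-2 * π * v * ξ) (-2 * π * v * ξ')
  have h2 : |(-2 * π * v * ξ) - (-2 * π * v * ξ')| = 2 * π * |ξ - ξ'| * |v| := by
    rw [show (-2 * π * v * ξ) - (-2 * π * v * ξ') = (-(2 * π)) * (v * (ξ - ξ')) by ring, abs_mul,
      abs_neg, abs_of_pos Real.two_pi_pos, abs_mul]
    ring
  rw [h2] at h
  have hW0 := weight_nonneg w B T v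
  calc ‖Complex.exp (((-2 * π * v * ξ : ℝ) : ℂ) * Complex.I) -
        Complex.exp (((-2 * π * v * ξ' : ℝ) : ℂ) * Complex.I)‖ * weight w B T v
      ≤ (2 * π * |ξ - ξ'| * |v|) * weight w B T v := mul_le_mul_of_nonneg_right h hW0
    _ = 2 * π * |ξ - ξ'| * (|v| * weight w B T v) := by ring

/-- (2) for the real `Ŵ_T`: `Ŵ_T(ξ) = 0` for `|ξ| > 2σ/T` (PROVED by the sibling
`weightHat_support_holds`). [cite: BondarenkoHeap2026, §2.1 (2) p. 5] -/
theorem weightHat_eq_zero_of_lt (w : Bump) (B : ℕ) {T : ℝ} (hT : 0 < T) {ξ : ℝ}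
    (hξ : 2 * w.σ / T < |ξ|) : weightHat w B T ξ = 0 := by
  rw [weightHat, weightHat_support_holds w B T hT ξ hξ, Complex.zero_re]

/-- **The three properties of `Ŵ_T` used for the off-diagonal** (uniform constants): there is
`K > 0` with, for all `T ≥ 1`: `|Ŵ_T(ξ)| ≤ K T`; `|Ŵ_T(ξ) − Ŵ_T(ξ′)| ≤ K T² |ξ − ξ′|`; and
`Ŵ_T(ξ) = 0` for `|ξ| > 2σ/T`. [cite: BondarenkoHeap2026, §4 p. 12 (proof of Theorem 3: "`Ŵ_T ≪_Φ T`", "from the support conditions of `Ŵ` we may restrict `|r| ≪_Φ M/T`")] -/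
theorem exists_weightHat_bounds (w : Bump) (B : ℕ) : ∃ K : ℝ, 0 < K ∧ ∀ T : ℝ, 1 ≤ T →
    (∀ ξ : ℝ, |weightHat w B T ξ| ≤ K * T) ∧
    (∀ ξ ξ' : ℝ, |weightHat w B T ξ - weightHat w B T ξ'| ≤ K * T ^ 2 * |ξ - ξ'|) ∧
    (∀ ξ : ℝ, 2 * w.σ / T < |ξ| → weightHat w B T ξ = 0) := by
  set K₀ : ℝ := ∫ t, weight w B 1 t with hK₀
  set K₁ : ℝ := ∫ t, |t| * weight w B 1 t with hK₁
  have hK₀0 : 0 ≤ K₀ := integral_nonneg fun t => weight_nonneg w B 1 t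
  have hK₁0 : 0 ≤ K₁ := integral_nonneg fun t => mul_nonneg (abs_nonneg t) (weight_nonneg w B 1 t)
  refine ⟨K₀ + 2 * π * K₁ + 1, by positivity, fun T hT => ⟨fun ξ => ?_, fun ξ ξ' => ?_, fun ξ hξ => ?_⟩⟩
  · have hT0 : 0 < T := by linarith
    calc |weightHat w B T ξ| ≤ ∫ t, weight w B T t := abs_weightHat_le_integral w B T ξ
      _ ≤ T * K₀ := integral_weight_le w B hT
      _ ≤ (K₀ + 2 * π * K₁ + 1) * T := by
          rw [mul_comm]
          exact mul_le_mul_of_nonneg_right (by nlinarith [Real.pi_pos]) hT0.le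
  · have hT0 : 0 < T := by linarith
    calc |weightHat w B T ξ - weightHat w B T ξ'|
        ≤ 2 * π * |ξ - ξ'| * ∫ t, |t| * weight w B T t := abs_weightHat_sub_le w B hT0 ξ ξ'
      _ ≤ 2 * π * |ξ - ξ'| * (T ^ 2 * K₁) := by
          gcongr
          exact integral_abs_mul_weight_le w B hT
      _ = (2 * π * K₁) * T ^ 2 * |ξ - ξ'| := by ring
      _ ≤ (K₀ + 2 * π * K₁ + 1) * T ^ 2 * |ξ - ξ'| := by
          gcongr
          linarith
  · exact weightHat_eq_zero_of_lt w B (by linarith) hξ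

end WeightHatBounds


section OffDiagonalPointwise

/-! ### Reindexing the off-diagonal by the shift `r = n − m` -/

/-- `∑_{m ≠ n ≤ N} F(m,n) = 2 ∑_{r ≥ 1} ∑_{m ≤ N − r} F(m, m + r)` for symmetric `F` ("put `n = m + r`").
[cite: BondarenkoHeap2026, §4 p. 12 (proof of Theorem 3: "For the off-diagonals, put `n = m + r`")] -/
theorem sum_offDiag_eq_two_mul_sum_shift (N : ℕ) (F : ℕ → ℕ → ℝ) (hF : ∀ m n, F m n = F n m) :
    ∑ m ∈ Icc 1 N, ∑ n ∈ Icc 1 N, (if m = n then 0 else F m n) =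
      2 * ∑ r ∈ Icc 1 N, ∑ m ∈ Icc 1 (N - r), F m (m + r) := by
  have hsplit : ∀ m ∈ Icc 1 N, ∑ n ∈ Icc 1 N, (if m = n then 0 else F m n) =
      ∑ n ∈ Icc 1 N, (if m < n then F m n else 0) +
        ∑ n ∈ Icc 1 N, (if n < m then F m n else 0) := by
    intro m _
    rw [← sum_add_distrib]
    refine sum_congr rfl fun n _ => ?_
    rcases lt_trichotomy m n with h | h | h
    · rw [if_neg h.ne, if_pos h, if_neg (not_lt.mpr h.le), add_zero]
    · subst h; simp
    · rw [if_neg h.ne', if_neg (not_lt.mpr h.le), if_pos h, zero_add]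
  rw [sum_congr rfl hsplit, sum_add_distrib]
  have hswap : ∑ m ∈ Icc 1 N, ∑ n ∈ Icc 1 N, (if n < m then F m n else 0) =
      ∑ m ∈ Icc 1 N, ∑ n ∈ Icc 1 N, (if m < n then F m n else 0) := by
    rw [sum_comm]
    refine sum_congr rfl fun n _ => sum_congr rfl fun m _ => ?_
    split_ifs with h
    · exact hF m n
    · rfl
  rw [hswap, ← two_mul]
  congr 1
  have hinner : ∀ m ∈ Icc 1 N, ∑ n ∈ Icc 1 N, (if m < n then F m n else 0) =
      ∑ r ∈ Icc 1 N, (if m + r ≤ N then F m (m + r) else 0) := by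
    intro m hm
    have hm1 := (mem_Icc.mp hm).1
    rw [← sum_filter, ← sum_filter]
    refine sum_nbij' (fun n => n - m) (fun r => m + r) ?_ ?_ ?_ ?_ ?_
    · intro n hn; simp only [mem_filter, mem_Icc] at hn ⊢; omega
    · intro r hr; simp only [mem_filter, mem_Icc] at hr ⊢; omega
    · intro n hn; simp only [mem_filter, mem_Icc] at hn; omega
    · intro r _; omega
    · intro n hn; simp only [mem_filter, mem_Icc] at hn; congr 1; omega
  rw [sum_congr rfl hinner, sum_comm]
  refine sum_congr rfl fun r hr => ?_
  have hr1 := (mem_Icc.mp hr).1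
  rw [← sum_filter]
  congr 1
  ext m; simp only [mem_filter, mem_Icc]; omega

/-- The summand of (15) is symmetric in `(m, n)` (`Ŵ_T` is even). [cite: BondarenkoHeap2026, §4 (15) p. 11] -/
theorem summand15_symm (w : Bump) (B : ℕ) (T : ℝ) (c : ℕ → ℝ) (m n : ℕ) :
    c m * c n / Real.sqrt ((m : ℝ) * n) * weightHat w B T (Real.log ((n : ℝ) / m) / (2 * π)) =
      c n * c m / Real.sqrt ((n : ℝ) * m) * weightHat w B T (Real.log ((m : ℝ) / n) / (2 * π)) := by
  have hlog : Real.log ((m : ℝ) / n) = -Real.log ((n : ℝ) / m) := by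
    rw [← Real.log_inv, inv_div]
  rw [hlog, neg_div, weightHat_even, mul_comm (c n) (c m), mul_comm (n : ℝ) (m : ℝ)]

/-- **The off-diagonal of (15) organised by the shift**:
`offDiagI0 = 2 ∑_{1 ≤ r ≤ N} ∑_{1 ≤ m ≤ N−r} r(m) r(m+r)/√(m(m+r)) Ŵ_T(log((m+r)/m)/2π)`, `N = ⌊L⌋`.
[cite: BondarenkoHeap2026, §4 p. 12 (proof of Theorem 3: "put `n = m + r`")] -/
theorem offDiagI0_eq_shift (w : Bump) (B : ℕ) (ρ : Resonator) {q : ℕ} (χ : DirichletCharacter ℂ q) :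
    offDiagI0 w B ρ χ = 2 * ∑ r ∈ Icc 1 ⌊lengthL q⌋₊, ∑ m ∈ Icc 1 (⌊lengthL q⌋₊ - r),
      ρ.coeff χ m * ρ.coeff χ (m + r) / Real.sqrt ((m : ℝ) * (m + r : ℕ)) *
        weightHat w B (ρ.T q) (Real.log (((m + r : ℕ) : ℝ) / m) / (2 * π)) := by
  rw [offDiagI0]
  exact sum_offDiag_eq_two_mul_sum_shift ⌊lengthL q⌋₊ _
    (fun m n => summand15_symm w B (ρ.T q) (ρ.coeff χ) m n)

/-- A quadratic character is real: `(χ a).im = 0`. [folklore] -/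
private theorem im_eq_zero_of_isQuadratic {q : ℕ} {χ : DirichletCharacter ℂ q}
    (hχ : χ.IsQuadratic) (a : ZMod q) : (χ a).im = 0 := by
  rcases hχ a with h | h | h <;> simp [h]

/-- `r(m) r(m+r) = Re(χ(m)χ(m+r)) · G(m)G(m+r)` for the quadratic `χ`. [cite: BondarenkoHeap2026, §2.3 p. 7 (r(n) = χ(n)G(n))] -/
theorem coeff_mul_coeff_shift {q : ℕ} {χ : DirichletCharacter ℂ q} (hχ : χ.IsQuadratic)
    (ρ : Resonator) (m r : ℕ) :
    ρ.coeff χ m * ρ.coeff χ (m + r) =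
      (χ (m : ZMod q) * χ ((1 * (m : ℤ) + r : ℤ) : ZMod q)).re * (ρ.G q m * ρ.G q (m + r)) := by
  have hcast : ((1 * (m : ℤ) + r : ℤ) : ZMod q) = ((m + r : ℕ) : ZMod q) := by push_cast; ring
  rw [hcast, Complex.mul_re, im_eq_zero_of_isQuadratic hχ, zero_mul, sub_zero, Resonator.coeff,
    Resonator.coeff]
  ring

/-- The inner sum for a fixed shift as the real part of a character sum against a real weight:
`∑_m r(m)r(m+r) P(m) = Re ∑_m (G(m)G(m+r)P(m)) χ(m) χ(m+r)`. [cite: BondarenkoHeap2026, §4 p. 12] -/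
theorem sum_coeff_shift_eq_re {q : ℕ} {χ : DirichletCharacter ℂ q} (hχ : χ.IsQuadratic)
    (ρ : Resonator) (r : ℕ) (S : Finset ℕ) (P : ℕ → ℝ) :
    ∑ m ∈ S, ρ.coeff χ m * ρ.coeff χ (m + r) * P m =
      (∑ m ∈ S, ((ρ.G q m * ρ.G q (m + r) * P m : ℝ) : ℂ) * χ (m : ZMod q) *
        χ ((1 * (m : ℤ) + r : ℤ) : ZMod q)).re := by
  rw [Complex.re_sum]
  refine sum_congr rfl fun m _ => ?_
  have h2 : (((ρ.G q m * ρ.G q (m + r) * P m : ℝ) : ℂ) * χ (m : ZMod q) *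
      χ ((1 * (m : ℤ) + r : ℤ) : ZMod q)).re =
      (ρ.G q m * ρ.G q (m + r) * P m) *
        (χ (m : ZMod q) * χ ((1 * (m : ℤ) + r : ℤ) : ZMod q)).re := by
    rw [mul_assoc, Complex.re_ofReal_mul]
  rw [h2, coeff_mul_coeff_shift hχ]
  ring

/-! ### The support cut and the size of `Ŵ_T(log(1 + r/m)/2π)` -/

/-- `log(1 + x) ≥ x/2` for `0 ≤ x ≤ 1`. [folklore] -/
private theorem half_le_log_one_add {x : ℝ} (hx0 : 0 ≤ x) (hx1 : x ≤ 1) :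
    x / 2 ≤ Real.log (1 + x) := by
  have h := Real.one_sub_inv_le_log_of_pos (by linarith : (0 : ℝ) < 1 + x)
  have h2 : x / 2 ≤ 1 - (1 + x)⁻¹ := by
    rw [show 1 - (1 + x)⁻¹ = x / (1 + x) by field_simp; ring]
    exact div_le_div_of_nonneg_left hx0 (by linarith) (by linarith)
  linarith

/-- **Support cut** ("from the support conditions of `Ŵ` we may restrict `|r| ≪_Φ M/T`"): if
`Ŵ_T` vanishes for `|ξ| > 2σ/T`, `T > 4πσ/log 2` and `8πσ m < r T`, then
`Ŵ_T(log((m+r)/m)/2π) = 0`. [cite: BondarenkoHeap2026, §4 p. 12 (proof of Theorem 3)] -/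
theorem weightHat_shift_eq_zero {σ T : ℝ} (hσ : 0 < σ) {W : ℝ → ℝ}
    (hW0 : ∀ ξ : ℝ, 2 * σ / T < |ξ| → W ξ = 0) (hT : 4 * π * σ / Real.log 2 < T)
    {m r : ℕ} (hm : 1 ≤ m) (h : 8 * π * σ * m < r * T) :
    W (Real.log (((m + r : ℕ) : ℝ) / m) / (2 * π)) = 0 := by
  have hm0 : (0 : ℝ) < m := by exact_mod_cast hm
  have hT0 : 0 < T := lt_trans (by positivity) hT
  have hlog2 : 0 < Real.log 2 := Real.log_pos one_lt_two
  set x : ℝ := (r : ℝ) / m with hx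
  have hx0 : 0 ≤ x := by positivity
  have h1x : ((m + r : ℕ) : ℝ) / m = 1 + x := by
    rw [hx]; push_cast; field_simp
  rw [h1x]
  apply hW0
  have hlogpos : 0 ≤ Real.log (1 + x) := Real.log_nonneg (by linarith)
  rw [abs_of_nonneg (by positivity), lt_div_iff₀ (by positivity)]
  by_cases hx1 : x ≤ 1
  · have hl := half_le_log_one_add hx0 hx1
    have hr : 8 * π * σ / T < x := by
      rw [div_lt_iff₀ hT0, hx, div_mul_eq_mul_div, lt_div_iff₀ hm0]
      linarith
    have : 2 * σ / T * (2 * π) = (8 * π * σ / T) / 2 := by ring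
    rw [this]
    linarith
  · push Not at hx1
    have hl : Real.log 2 ≤ Real.log (1 + x) := Real.log_le_log two_pos (by linarith)
    have h2 : 2 * σ / T * (2 * π) < Real.log 2 := by
      rw [div_lt_iff₀ hlog2] at hT
      rw [div_mul_eq_mul_div, div_lt_iff₀ hT0]
      linarith
    linarith

/-- `√(m(m+r)) ≥ m`. [folklore] -/
private theorem le_sqrt_mul_add (m r : ℕ) : (m : ℝ) ≤ Real.sqrt ((m : ℝ) * (m + r : ℕ)) := by
  have hm : (0 : ℝ) ≤ m := Nat.cast_nonneg m
  calc (m : ℝ) = Real.sqrt ((m : ℝ) * m) := (Real.sqrt_mul_self hm).symm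
    _ ≤ Real.sqrt ((m : ℝ) * (m + r : ℕ)) := by
        refine Real.sqrt_le_sqrt ?_
        push_cast
        nlinarith [(Nat.cast_nonneg r : (0 : ℝ) ≤ r)]

/-- **Size of one term**: `|G(m)G(m+r)/√(m(m+r)) · Ŵ| ≤ M_G² K T/m`. [cite: BondarenkoHeap2026, §4 p. 12 ("`Ŵ_T ≪_Φ T`")] -/
theorem abs_shiftTerm_le {G : ℕ → ℝ} {MG : ℝ} (hG : ∀ n, |G n| ≤ MG) {W : ℝ → ℝ} {KT : ℝ}
    (hW : ∀ ξ, |W ξ| ≤ KT) {m : ℕ} (hm : 1 ≤ m) (r : ℕ) (ξ : ℝ) :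
    |G m * G (m + r) / Real.sqrt ((m : ℝ) * (m + r : ℕ)) * W ξ| ≤ MG ^ 2 * KT / m := by
  have hm0 : (0 : ℝ) < m := by exact_mod_cast hm
  have hMG : 0 ≤ MG := (abs_nonneg _).trans (hG 0)
  have hKT : 0 ≤ KT := (abs_nonneg _).trans (hW 0)
  have hs := le_sqrt_mul_add m r
  have hs0 : 0 < Real.sqrt ((m : ℝ) * (m + r : ℕ)) := lt_of_lt_of_le hm0 hs
  rw [abs_mul, abs_div, abs_mul, abs_of_pos hs0]
  have h1 : |G m| * |G (m + r)| / Real.sqrt ((m : ℝ) * (m + r : ℕ)) ≤ MG * MG / m := by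
    calc |G m| * |G (m + r)| / Real.sqrt ((m : ℝ) * (m + r : ℕ))
        ≤ |G m| * |G (m + r)| / m := div_le_div_of_nonneg_left (by positivity) hm0 hs
      _ ≤ MG * MG / m := by gcongr <;> exact hG _
  calc |G m| * |G (m + r)| / Real.sqrt ((m : ℝ) * (m + r : ℕ)) * |W ξ|
      ≤ MG * MG / m * KT := mul_le_mul h1 (hW ξ) (abs_nonneg _) (by positivity)
    _ = MG ^ 2 * KT / m := by ring

/-! ### Discrete differences -/

/-- `|log((m+1+r)/(m+1)) − log((m+r)/m)| ≤ r/m²` (`m ≥ 1`). [folklore] -/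
private theorem abs_log_shift_sub_le {m : ℕ} (hm : 1 ≤ m) (r : ℕ) :
    |Real.log (((m + 1 + r : ℕ) : ℝ) / (m + 1 : ℕ)) - Real.log (((m + r : ℕ) : ℝ) / m)| ≤
      (r : ℝ) / (m : ℝ) ^ 2 := by
  have hm0 : (0 : ℝ) < m := by exact_mod_cast hm
  have hr0 : (0 : ℝ) ≤ r := Nat.cast_nonneg r
  have hA : (0 : ℝ) < ((m + 1 + r : ℕ) : ℝ) / (m + 1 : ℕ) := by positivity
  have hB : (0 : ℝ) < ((m + r : ℕ) : ℝ) / m := by push_cast; positivity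
  rw [← Real.log_div hA.ne' hB.ne']
  set y : ℝ := ((m + 1 + r : ℕ) : ℝ) / (m + 1 : ℕ) / (((m + r : ℕ) : ℝ) / m) with hy
  have hy0 : 0 < y := by positivity
  have hyval : y = ((m : ℝ) * (m + 1 + r)) / ((m + 1) * (m + r)) := by
    rw [hy]; push_cast; field_simp
  have hy1 : y ≤ 1 := by
    rw [hyval, div_le_one (by positivity)]; nlinarith
  have hlog0 : Real.log y ≤ 0 := Real.log_nonpos hy0.le hy1
  rw [abs_of_nonpos hlog0]
  have h1 : -Real.log y ≤ y⁻¹ - 1 := by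
    rw [← Real.log_inv]
    exact Real.log_le_sub_one_of_pos (inv_pos.mpr hy0)
  have h2 : y⁻¹ - 1 = (r : ℝ) / ((m : ℝ) * (m + 1 + r)) := by
    rw [hyval, inv_div]; field_simp; ring
  have h3 : (r : ℝ) / ((m : ℝ) * (m + 1 + r)) ≤ (r : ℝ) / (m : ℝ) ^ 2 :=
    div_le_div_of_nonneg_left hr0 (by positivity) (by nlinarith)
  linarith

/-- `|1/√((m+1)(m+1+r)) − 1/√(m(m+r))| ≤ 2/m²` (`m ≥ 1`; crude). [folklore] -/
private theorem abs_inv_sqrt_shift_sub_le {m : ℕ} (hm : 1 ≤ m) (r : ℕ) :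
    |1 / Real.sqrt (((m + 1 : ℕ) : ℝ) * (m + 1 + r : ℕ)) - 1 / Real.sqrt ((m : ℝ) * (m + r : ℕ))| ≤
      2 / (m : ℝ) ^ 2 := by
  have hm0 : (0 : ℝ) < m := by exact_mod_cast hm
  have hr0 : (0 : ℝ) ≤ r := Nat.cast_nonneg r
  set A : ℝ := (m : ℝ) * (m + r : ℕ) with hA
  set B : ℝ := ((m + 1 : ℕ) : ℝ) * (m + 1 + r : ℕ) with hB
  have hAval : A = (m : ℝ) * (m + r) := by rw [hA]; push_cast; ring
  have hBval : B = ((m : ℝ) + 1) * (m + 1 + r) := by rw [hB]; push_cast; ring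
  have hA0 : 0 < A := by rw [hAval]; positivity
  have hB0 : 0 < B := by rw [hBval]; positivity
  have hAB : A ≤ B := by rw [hAval, hBval]; nlinarith
  have hBA : B - A = 2 * m + 1 + r := by rw [hAval, hBval]; ring
  have hsA : 0 < Real.sqrt A := Real.sqrt_pos.mpr hA0
  have hsB : 0 < Real.sqrt B := Real.sqrt_pos.mpr hB0
  have hsAB : Real.sqrt A ≤ Real.sqrt B := Real.sqrt_le_sqrt hAB
  have hmA : (m : ℝ) ≤ Real.sqrt A := le_sqrt_mul_add m r
  have hAA : Real.sqrt A * Real.sqrt A = A := Real.mul_self_sqrt hA0.le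
  have hBB : Real.sqrt B * Real.sqrt B = B := Real.mul_self_sqrt hB0.le
  have hdiff : 1 / Real.sqrt A - 1 / Real.sqrt B =
      (Real.sqrt B - Real.sqrt A) / (Real.sqrt A * Real.sqrt B) := by
    field_simp
  have hroot : Real.sqrt B - Real.sqrt A = (B - A) / (Real.sqrt A + Real.sqrt B) := by
    field_simp
    nlinarith [hAA, hBB]
  have hnn : 0 ≤ 1 / Real.sqrt A - 1 / Real.sqrt B := by
    rw [hdiff]; exact div_nonneg (by linarith) (by positivity)
  rw [abs_sub_comm, abs_of_nonneg hnn, hdiff, hroot, hBA, div_div,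
    div_le_div_iff₀ (by positivity) (by positivity)]
  -- `(2m+1+r) m² ≤ 2 (√A+√B) √A √B`, using `(√A+√B)√A√B ≥ 2 m A = 2 m²(m+r)`
  have hlow : 2 * (m : ℝ) * A ≤ (Real.sqrt A + Real.sqrt B) * (Real.sqrt A * Real.sqrt B) := by
    have h1 : Real.sqrt A * Real.sqrt A ≤ Real.sqrt A * Real.sqrt B :=
      mul_le_mul_of_nonneg_left hsAB hsA.le
    have h2 : 2 * Real.sqrt A ≤ Real.sqrt A + Real.sqrt B := by linarith
    calc 2 * (m : ℝ) * A ≤ 2 * Real.sqrt A * A := by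
          have := hA0.le; nlinarith
      _ = (2 * Real.sqrt A) * (Real.sqrt A * Real.sqrt A) := by rw [hAA]
      _ ≤ (Real.sqrt A + Real.sqrt B) * (Real.sqrt A * Real.sqrt B) :=
          mul_le_mul h2 h1 (by positivity) (by positivity)
  rw [hAval] at hlow
  nlinarith [hlow, hm0, hr0]

end OffDiagonalPointwise



section OffDiagonalVariation

/-! ### Elementary tail sums -/

/-- `∑_{a ≤ m ≤ b} 1/m² ≤ 2/a` (`a ≥ 1`). [folklore] -/
private theorem sum_Icc_inv_sq_le {a : ℕ} (ha : 1 ≤ a) (b : ℕ) :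
    ∑ m ∈ Icc a b, 1 / (m : ℝ) ^ 2 ≤ (2 : ℝ) / (a : ℝ) := by
  have ha0 : (0 : ℝ) < a := by exact_mod_cast ha
  have ha1 : (1 : ℝ) ≤ a := by exact_mod_cast ha
  by_cases hab : a ≤ b
  · -- `∑_{a}^{b} 1/m² ≤ 2/a − 1/b` by induction on `b ≥ a`
    suffices h : ∑ m ∈ Icc a b, 1 / (m : ℝ) ^ 2 ≤ (2 : ℝ) / (a : ℝ) - 1 / (b : ℝ) by
      have hb0 : (0 : ℝ) < b := by exact_mod_cast lt_of_lt_of_le ha hab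
      have : (0 : ℝ) ≤ 1 / (b : ℝ) := by positivity
      linarith
    induction b, hab using Nat.le_induction with
    | base =>
      rw [Icc_self, sum_singleton]
      have : 1 / (a : ℝ) ^ 2 ≤ 1 / (a : ℝ) := by
        rw [div_le_div_iff₀ (by positivity) ha0]; nlinarith
      have h2 : (2 : ℝ) / (a : ℝ) - 1 / (a : ℝ) = 1 / (a : ℝ) := by ring
      linarith
    | succ b hab ih =>
      have hb0 : (0 : ℝ) < b := by exact_mod_cast lt_of_lt_of_le ha hab
      rw [sum_Icc_succ_top (by omega), add_comm]
      have hstep : 1 / ((b + 1 : ℕ) : ℝ) ^ 2 ≤ 1 / (b : ℝ) - 1 / ((b + 1 : ℕ) : ℝ) := by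
        push_cast
        rw [div_sub_div _ _ hb0.ne' (by positivity), div_le_div_iff₀ (by positivity) (by positivity)]
        nlinarith
      linarith

  · push Not at hab
    rw [Icc_eq_empty (by omega), sum_empty]
    positivity

/-- `∑_{a ≤ m ≤ b} 1/m³ ≤ 2/a²` (`a ≥ 1`). [folklore] -/
private theorem sum_Icc_inv_cube_le {a : ℕ} (ha : 1 ≤ a) (b : ℕ) :
    ∑ m ∈ Icc a b, 1 / (m : ℝ) ^ 3 ≤ (2 : ℝ) / (a : ℝ) ^ 2 := by
  have ha0 : (0 : ℝ) < a := by exact_mod_cast ha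
  calc ∑ m ∈ Icc a b, 1 / (m : ℝ) ^ 3 ≤ ∑ m ∈ Icc a b, (1 / (a : ℝ)) * (1 / (m : ℝ) ^ 2) := by
        refine sum_le_sum fun m hm => ?_
        have ham : (a : ℝ) ≤ m := by exact_mod_cast (mem_Icc.mp hm).1
        have hm0 : (0 : ℝ) < m := lt_of_lt_of_le ha0 ham
        rw [one_div_mul_one_div, div_le_div_iff₀ (by positivity) (by positivity), one_mul, one_mul]
        have := mul_le_mul_of_nonneg_right ham (sq_nonneg (m : ℝ))
        nlinarith
    _ = (1 / (a : ℝ)) * ∑ m ∈ Icc a b, 1 / (m : ℝ) ^ 2 := by rw [mul_sum]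
    _ ≤ (1 / (a : ℝ)) * ((2 : ℝ) / (a : ℝ)) :=
        mul_le_mul_of_nonneg_left (sum_Icc_inv_sq_le ha b) (by positivity)
    _ = (2 : ℝ) / (a : ℝ) ^ 2 := by rw [one_div_mul_eq_div]; ring

/-- `∑_{1 ≤ m ≤ N} 1/m ≤ 1 + log N` (`N ≥ 1`), hence `≤ 1 + log X` whenever `N ≤ X`. [folklore] -/
private theorem sum_Icc_inv_le_log {N : ℕ} {X : ℝ} (hX : 1 ≤ X) (hN : (N : ℝ) ≤ X) :
    ∑ m ∈ Icc 1 N, 1 / (m : ℝ) ≤ 1 + Real.log X := by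
  rcases Nat.eq_zero_or_pos N with rfl | hNpos
  · simp; linarith [Real.log_nonneg hX]
  have hlogN : Real.log N ≤ Real.log X := Real.log_le_log (by exact_mod_cast hNpos) hN
  suffices h : ∑ m ∈ Icc 1 N, 1 / (m : ℝ) ≤ 1 + Real.log N by linarith
  clear hN hlogN
  induction N, hNpos using Nat.le_induction with
  | base => simp
  | succ n hn ih =>
    have hn0 : (0 : ℝ) < n := by exact_mod_cast hn
    rw [sum_Icc_succ_top (by omega), add_comm]
    have hstep : 1 / ((n + 1 : ℕ) : ℝ) ≤ Real.log ((n + 1 : ℕ) : ℝ) - Real.log n := by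
      rw [← Real.log_div (by positivity) hn0.ne']
      have h := Real.one_sub_inv_le_log_of_pos (by positivity : (0 : ℝ) < ((n + 1 : ℕ) : ℝ) / n)
      have h2 : 1 - (((n + 1 : ℕ) : ℝ) / n)⁻¹ = 1 / ((n + 1 : ℕ) : ℝ) := by
        rw [inv_div]; push_cast; field_simp; ring
      linarith
    linarith

/-! ### The resonator weight has small differences: `|G(n+1) − G(n)| ≤ D_a/n + D_b/L` -/

/-- A `C¹` function with `|g′| ≤ C` on `[0, 2]` is `C`-Lipschitz there. [folklore] -/
private theorem abs_sub_le_of_deriv_bound {g : ℝ → ℝ} (hg : Differentiable ℝ g) {C : ℝ}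
    (hC : ∀ x ∈ Set.Icc (0 : ℝ) 2, |deriv g x| ≤ C) {x y : ℝ} (hx : x ∈ Set.Icc (0 : ℝ) 2)
    (hy : y ∈ Set.Icc (0 : ℝ) 2) : |g y - g x| ≤ C * |y - x| := by
  have h := Convex.norm_image_sub_le_of_norm_deriv_le (s := Set.Icc (0 : ℝ) 2)
    (fun z _ => hg.differentiableAt) (fun z hz => by rw [Real.norm_eq_abs]; exact hC z hz)
    (convex_Icc 0 2) hx hy
  simpa only [Real.norm_eq_abs] using h

/-- **Differences of `G`**: there are `D_a, D_b ≥ 0` (depending on the resonator only) with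
`|G(n+1) − G(n)| ≤ D_a/n + D_b/L` for `1 ≤ n ≤ L`, `L ≥ 3` (`G(n) = G₀(log n/log L) f₀(n/L)`, `G₀`
a polynomial, `f₀` smooth). [cite: BondarenkoHeap2026, §2.3 p. 8 (G(n)), §4 p. 12 ("`‖V‖_BV ≪ 1`")] -/
theorem exists_G_diff_bound (ρ : Resonator) : ∃ Da Db : ℝ, 0 ≤ Da ∧ 0 ≤ Db ∧
    ∀ q : ℕ, 3 ≤ lengthL q → ∀ n : ℕ, 1 ≤ n → (n : ℝ) ≤ lengthL q →
      |ρ.G q (n + 1) - ρ.G q n| ≤ Da / n + Db / lengthL q := by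
  -- bounds for `G₀`, `G₀'`, `f₀`, `f₀'` on `[0, 2]`
  have hK : IsCompact (Set.Icc (0 : ℝ) 2) := isCompact_Icc
  obtain ⟨B0, hB0⟩ := hK.exists_bound_of_continuousOn (f := fun x => ρ.G₀.eval x)
    (ρ.G₀.continuous).continuousOn
  obtain ⟨L0, hL0⟩ := hK.exists_bound_of_continuousOn (f := fun x => deriv (fun x => ρ.G₀.eval x) x)
    (by
      have : (fun x => deriv (fun x => ρ.G₀.eval x) x) = fun x => ρ.G₀.derivative.eval x := by
        funext x; exact ρ.G₀.deriv
      rw [this]; exact (Polynomial.continuous _).continuousOn)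
  obtain ⟨Bf, hBf⟩ := hK.exists_bound_of_continuousOn (f := ρ.f₀) ρ.f₀_smooth.continuous.continuousOn
  obtain ⟨Lf, hLf⟩ := hK.exists_bound_of_continuousOn (f := deriv ρ.f₀)
    (ρ.f₀_smooth.continuous_deriv (by simp)).continuousOn
  have hB0' : ∀ x ∈ Set.Icc (0 : ℝ) 2, |ρ.G₀.eval x| ≤ B0 := fun x hx => by
    have := hB0 x hx; rwa [Real.norm_eq_abs] at this
  have hL0' : ∀ x ∈ Set.Icc (0 : ℝ) 2, |deriv (fun x => ρ.G₀.eval x) x| ≤ L0 := fun x hx => by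
    have := hL0 x hx; rwa [Real.norm_eq_abs] at this
  have hBf' : ∀ x ∈ Set.Icc (0 : ℝ) 2, |ρ.f₀ x| ≤ Bf := fun x hx => by
    have := hBf x hx; rwa [Real.norm_eq_abs] at this
  have hLf' : ∀ x ∈ Set.Icc (0 : ℝ) 2, |deriv ρ.f₀ x| ≤ Lf := fun x hx => by
    have := hLf x hx; rwa [Real.norm_eq_abs] at this
  have hB00 : 0 ≤ B0 := (abs_nonneg _).trans (hB0' 0 (by simp))
  have hL00 : 0 ≤ L0 := (abs_nonneg _).trans (hL0' 0 (by simp))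
  have hBf0 : 0 ≤ Bf := (abs_nonneg _).trans (hBf' 0 (by simp))
  have hLf0 : 0 ≤ Lf := (abs_nonneg _).trans (hLf' 0 (by simp))
  have hdG0 : Differentiable ℝ fun x => ρ.G₀.eval x := ρ.G₀.differentiable
  have hdf : Differentiable ℝ ρ.f₀ := ρ.f₀_smooth.differentiable (by simp)
  refine ⟨L0 * Bf, B0 * Lf, by positivity, by positivity, ?_⟩
  intro q hL n hn hnL
  set L := lengthL q with hLdef
  have hL1 : (1 : ℝ) < L := by linarith
  have hlogL : 1 ≤ Real.log L := by
    rw [← Real.log_exp 1]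
    refine Real.log_le_log (Real.exp_pos 1) (le_trans ?_ hL)
    have := Real.exp_one_lt_d9; norm_num at this ⊢; linarith
  have hlogL0 : 0 < Real.log L := by linarith
  have hn0 : (0 : ℝ) < n := by exact_mod_cast hn
  -- the four evaluation points lie in `[0, 2]`
  have hu : ∀ k : ℕ, 1 ≤ k → (k : ℝ) ≤ L + 1 → Real.log k / Real.log L ∈ Set.Icc (0 : ℝ) 2 := by
    intro k hk hkL
    have hk0 : (1 : ℝ) ≤ k := by exact_mod_cast hk
    refine ⟨div_nonneg (Real.log_nonneg hk0) hlogL0.le, ?_⟩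
    rw [div_le_iff₀ hlogL0]
    have h1 : Real.log k ≤ Real.log (L + 1) := Real.log_le_log (by linarith) hkL
    have h2 : Real.log (L + 1) ≤ Real.log (L * L) :=
      Real.log_le_log (by linarith) (by nlinarith)
    rw [Real.log_mul (by linarith) (by linarith)] at h2
    linarith
  have hv : ∀ k : ℕ, (k : ℝ) ≤ L + 1 → (k : ℝ) / L ∈ Set.Icc (0 : ℝ) 2 := by
    intro k hkL
    refine ⟨by positivity, ?_⟩
    rw [div_le_iff₀ (by linarith)]; linarith
  have hn1L : ((n + 1 : ℕ) : ℝ) ≤ L + 1 := by push_cast; linarith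
  have hnL' : (n : ℝ) ≤ L + 1 := by linarith
  -- split the difference
  have hsplit : ρ.G q (n + 1) - ρ.G q n =
      (ρ.G₀.eval (Real.log ((n + 1 : ℕ) : ℝ) / Real.log L) - ρ.G₀.eval (Real.log n / Real.log L)) *
          ρ.f₀ (((n + 1 : ℕ) : ℝ) / L) +
        ρ.G₀.eval (Real.log n / Real.log L) * (ρ.f₀ (((n + 1 : ℕ) : ℝ) / L) - ρ.f₀ (n / L)) := by
    simp only [Resonator.G, hLdef]; ring
  rw [hsplit]
  have h1 : |ρ.G₀.eval (Real.log ((n + 1 : ℕ) : ℝ) / Real.log L) - ρ.G₀.eval (Real.log n / Real.log L)|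
      ≤ L0 * (1 / (n * Real.log L)) := by
    refine (abs_sub_le_of_deriv_bound hdG0 hL0' (hu n hn hnL') (hu (n + 1) (by omega) hn1L)).trans ?_
    refine mul_le_mul_of_nonneg_left ?_ hL00
    rw [← sub_div, abs_div, abs_of_pos hlogL0, ← Real.log_div (by positivity) hn0.ne',
      div_le_div_iff₀ hlogL0 (by positivity)]
    have hq : Real.log (((n + 1 : ℕ) : ℝ) / n) ≤ 1 / n := by
      have := Real.log_le_sub_one_of_pos (by positivity : (0 : ℝ) < ((n + 1 : ℕ) : ℝ) / n)
      have h2 : ((n + 1 : ℕ) : ℝ) / n - 1 = 1 / n := by push_cast; field_simp; ring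
      linarith
    have hq0 : 0 ≤ Real.log (((n + 1 : ℕ) : ℝ) / n) :=
      Real.log_nonneg (by rw [le_div_iff₀ hn0]; push_cast; linarith)
    rw [abs_of_nonneg hq0]
    calc Real.log (((n + 1 : ℕ) : ℝ) / n) * (n * Real.log L) ≤ 1 / n * (n * Real.log L) :=
          mul_le_mul_of_nonneg_right hq (by positivity)
      _ = 1 * Real.log L := by field_simp
  have h2 : |ρ.f₀ (((n + 1 : ℕ) : ℝ) / L) - ρ.f₀ (n / L)| ≤ Lf * (1 / L) := by
    refine (abs_sub_le_of_deriv_bound hdf hLf' (hv n hnL') (hv (n + 1) hn1L)).trans ?_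
    refine mul_le_mul_of_nonneg_left (le_of_eq ?_) hLf0
    rw [← sub_div, abs_div, abs_of_pos (by linarith : (0 : ℝ) < L)]
    congr 1; push_cast; rw [show (n : ℝ) + 1 - n = 1 by ring, abs_one]
  calc |(ρ.G₀.eval (Real.log ((n + 1 : ℕ) : ℝ) / Real.log L) - ρ.G₀.eval (Real.log n / Real.log L)) *
          ρ.f₀ (((n + 1 : ℕ) : ℝ) / L) +
        ρ.G₀.eval (Real.log n / Real.log L) * (ρ.f₀ (((n + 1 : ℕ) : ℝ) / L) - ρ.f₀ (n / L))|
      ≤ |ρ.G₀.eval (Real.log ((n + 1 : ℕ) : ℝ) / Real.log L) - ρ.G₀.eval (Real.log n / Real.log L)| *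
          |ρ.f₀ (((n + 1 : ℕ) : ℝ) / L)| +
        |ρ.G₀.eval (Real.log n / Real.log L)| * |ρ.f₀ (((n + 1 : ℕ) : ℝ) / L) - ρ.f₀ (n / L)| := by
        refine (abs_add_le _ _).trans ?_; rw [abs_mul, abs_mul]
    _ ≤ L0 * (1 / (n * Real.log L)) * Bf + B0 * (Lf * (1 / L)) :=
        add_le_add (mul_le_mul h1 (hBf' _ (hv (n + 1) hn1L)) (abs_nonneg _) (by positivity))
          (mul_le_mul (hB0' _ (hu n hn hnL')) h2 (abs_nonneg _) hB00)
    _ ≤ L0 * Bf / n + B0 * Lf / L := by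
        have hh : L0 * (1 / (n * Real.log L)) * Bf ≤ L0 * Bf / n := by
          rw [show L0 * (1 / (n * Real.log L)) * Bf = L0 * Bf / n * (1 / Real.log L) by
            field_simp]
          exact mul_le_of_le_one_right (by positivity) (by
            rw [div_le_one hlogL0]; exact hlogL)
        have hh2 : B0 * (Lf * (1 / L)) = B0 * Lf / L := by ring
        linarith [hh2.le]

/-! ### The discrete variation of the shift weight `f_r(m) = G(m)G(m+r)/√(m(m+r)) Ŵ(ξ_m)` -/

/-- **One difference.** With `|G| ≤ M_G`, `|G(n+1) − G(n)| ≤ D_a/n + D_b` (`1 ≤ n ≤ N`),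
`|Ŵ| ≤ K_T`, `|Ŵ(ξ) − Ŵ(ξ′)| ≤ K_{T²}|ξ − ξ′|`, for `1 ≤ m`, `m + r + 1 ≤ N`:
`|f_r(m+1) − f_r(m)| ≤ K_T(2M_G D_a + 2M_G²)/m² + 2K_T M_G D_b/m + M_G² K_{T²} r/m³`.
[cite: BondarenkoHeap2026, §4 p. 12 ("`‖V‖_BV ≪ 1` since `Ŵ_T ≪_Φ T`")] -/
theorem abs_shiftWeight_diff_le {G : ℕ → ℝ} {MG Da Db KT KT2 : ℝ} {N : ℕ}
    (hG : ∀ n, |G n| ≤ MG) (hΔG : ∀ n, 1 ≤ n → n ≤ N → |G (n + 1) - G n| ≤ Da / n + Db)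
    (hDa : 0 ≤ Da) (hDb : 0 ≤ Db) {W : ℝ → ℝ} (hW : ∀ ξ, |W ξ| ≤ KT)
    (hWlip : ∀ ξ ξ', |W ξ - W ξ'| ≤ KT2 * |ξ - ξ'|) (hKT2 : 0 ≤ KT2)
    {m r : ℕ} (hm : 1 ≤ m) (hmr : m + r + 1 ≤ N) :
    |G (m + 1) * G (m + 1 + r) / Real.sqrt (((m + 1 : ℕ) : ℝ) * (m + 1 + r : ℕ)) *
          W (Real.log (((m + 1 + r : ℕ) : ℝ) / (m + 1 : ℕ)) / (2 * π)) -
        G m * G (m + r) / Real.sqrt ((m : ℝ) * (m + r : ℕ)) *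
          W (Real.log (((m + r : ℕ) : ℝ) / m) / (2 * π))| ≤
      KT * (2 * MG * Da + 2 * MG ^ 2) / (m : ℝ) ^ 2 + 2 * KT * MG * Db / m +
        MG ^ 2 * KT2 * r / (m : ℝ) ^ 3 := by
  have hm0 : (0 : ℝ) < m := by exact_mod_cast hm
  have hMG : 0 ≤ MG := (abs_nonneg _).trans (hG 0)
  have hKT : 0 ≤ KT := (abs_nonneg _).trans (hW 0)
  -- abbreviations
  set s0 : ℝ := 1 / Real.sqrt ((m : ℝ) * (m + r : ℕ)) with hs0
  set s1 : ℝ := 1 / Real.sqrt (((m + 1 : ℕ) : ℝ) * (m + 1 + r : ℕ)) with hs1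
  set ξ0 : ℝ := Real.log (((m + r : ℕ) : ℝ) / m) / (2 * π) with hξ0
  set ξ1 : ℝ := Real.log (((m + 1 + r : ℕ) : ℝ) / (m + 1 : ℕ)) / (2 * π) with hξ1
  have hsq0 : (m : ℝ) ≤ Real.sqrt ((m : ℝ) * (m + r : ℕ)) := by
    calc (m : ℝ) = Real.sqrt ((m : ℝ) * m) := (Real.sqrt_mul_self hm0.le).symm
      _ ≤ _ := Real.sqrt_le_sqrt (by push_cast; nlinarith [(Nat.cast_nonneg r : (0 : ℝ) ≤ r)])
  have hsq1 : ((m + 1 : ℕ) : ℝ) ≤ Real.sqrt (((m + 1 : ℕ) : ℝ) * (m + 1 + r : ℕ)) := by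
    have h0 : (0 : ℝ) ≤ ((m + 1 : ℕ) : ℝ) := by positivity
    calc ((m + 1 : ℕ) : ℝ) = Real.sqrt (((m + 1 : ℕ) : ℝ) * (m + 1 : ℕ)) :=
          (Real.sqrt_mul_self h0).symm
      _ ≤ _ := Real.sqrt_le_sqrt (by push_cast; nlinarith [(Nat.cast_nonneg r : (0 : ℝ) ≤ r)])
  have hs0le : |s0| ≤ 1 / m := by
    rw [hs0, abs_of_nonneg (by positivity)]
    exact div_le_div_of_nonneg_left zero_le_one hm0 hsq0
  have hs1le : |s1| ≤ 1 / m := by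
    rw [hs1, abs_of_nonneg (by positivity)]
    refine (div_le_div_of_nonneg_left zero_le_one (by positivity) hsq1).trans ?_
    exact div_le_div_of_nonneg_left zero_le_one hm0 (by push_cast; linarith)
  have hds : |s1 - s0| ≤ 2 / (m : ℝ) ^ 2 := abs_inv_sqrt_shift_sub_le hm r
  have hdξ : |ξ1 - ξ0| ≤ r / (m : ℝ) ^ 2 := by
    rw [hξ1, hξ0, ← sub_div, abs_div, abs_of_pos Real.two_pi_pos]
    have h := abs_log_shift_sub_le hm r
    calc |Real.log (((m + 1 + r : ℕ) : ℝ) / (m + 1 : ℕ)) - Real.log (((m + r : ℕ) : ℝ) / m)| / (2 * π)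
        ≤ |Real.log (((m + 1 + r : ℕ) : ℝ) / (m + 1 : ℕ)) - Real.log (((m + r : ℕ) : ℝ) / m)| / 1 :=
          div_le_div_of_nonneg_left (abs_nonneg _) one_pos (by linarith [Real.pi_gt_three])
      _ ≤ r / (m : ℝ) ^ 2 := by rw [div_one]; exact h
  -- `G` differences at `m` and at `m + r`
  have hG1 : |G (m + 1) - G m| ≤ Da / m + Db := hΔG m hm (by omega)
  have hG2 : |G (m + 1 + r) - G (m + r)| ≤ Da / m + Db := by
    have h := hΔG (m + r) (by omega) (by omega)
    rw [show m + r + 1 = m + 1 + r by ring] at h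
    have hmr' : Da / ((m + r : ℕ) : ℝ) ≤ Da / m :=
      div_le_div_of_nonneg_left hDa hm0 (by push_cast; linarith [(Nat.cast_nonneg r : (0 : ℝ) ≤ r)])
    linarith [h, hmr']
  -- rewrite the difference
  have hrw : G (m + 1) * G (m + 1 + r) / Real.sqrt (((m + 1 : ℕ) : ℝ) * (m + 1 + r : ℕ)) * W ξ1 -
        G m * G (m + r) / Real.sqrt ((m : ℝ) * (m + r : ℕ)) * W ξ0 =
      ((G (m + 1) - G m) * G (m + 1 + r) * s1 + G m * (G (m + 1 + r) - G (m + r)) * s1 +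
          G m * G (m + r) * (s1 - s0)) * W ξ1 +
        G m * G (m + r) * s0 * (W ξ1 - W ξ0) := by
    rw [hs0, hs1]; ring
  rw [hrw]
  have hP : |(G (m + 1) - G m) * G (m + 1 + r) * s1 + G m * (G (m + 1 + r) - G (m + r)) * s1 +
      G m * G (m + r) * (s1 - s0)| ≤
      (Da / m + Db) * MG * (1 / m) + MG * (Da / m + Db) * (1 / m) + MG * MG * (2 / (m : ℝ) ^ 2) := by
    refine (abs_add_le _ _).trans (add_le_add ((abs_add_le _ _).trans (add_le_add ?_ ?_)) ?_)
    · rw [abs_mul, abs_mul]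
      exact mul_le_mul (mul_le_mul hG1 (hG _) (abs_nonneg _) (by positivity)) hs1le
        (abs_nonneg _) (by positivity)
    · rw [abs_mul, abs_mul]
      exact mul_le_mul (mul_le_mul (hG _) hG2 (abs_nonneg _) hMG) hs1le (abs_nonneg _)
        (by positivity)
    · rw [abs_mul, abs_mul]
      exact mul_le_mul (mul_le_mul (hG _) (hG _) (abs_nonneg _) hMG) hds (abs_nonneg _)
        (by positivity)
  have hQ : |G m * G (m + r) * s0 * (W ξ1 - W ξ0)| ≤ MG * MG * (1 / m) * (KT2 * (r / (m : ℝ) ^ 2)) := by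
    rw [abs_mul, abs_mul, abs_mul]
    refine mul_le_mul (mul_le_mul (mul_le_mul (hG _) (hG _) (abs_nonneg _) hMG) hs0le
      (abs_nonneg _) (by positivity)) ((hWlip _ _).trans (mul_le_mul_of_nonneg_left hdξ hKT2))
      (abs_nonneg _) (by positivity)
  calc |((G (m + 1) - G m) * G (m + 1 + r) * s1 + G m * (G (m + 1 + r) - G (m + r)) * s1 +
          G m * G (m + r) * (s1 - s0)) * W ξ1 + G m * G (m + r) * s0 * (W ξ1 - W ξ0)|
      ≤ |((G (m + 1) - G m) * G (m + 1 + r) * s1 + G m * (G (m + 1 + r) - G (m + r)) * s1 +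
          G m * G (m + r) * (s1 - s0))| * |W ξ1| + |G m * G (m + r) * s0 * (W ξ1 - W ξ0)| := by
        refine (abs_add_le _ _).trans ?_; rw [abs_mul]
    _ ≤ ((Da / m + Db) * MG * (1 / m) + MG * (Da / m + Db) * (1 / m) + MG * MG * (2 / (m : ℝ) ^ 2)) *
          KT + MG * MG * (1 / m) * (KT2 * (r / (m : ℝ) ^ 2)) :=
        add_le_add (mul_le_mul hP (hW _) (abs_nonneg _) (by positivity)) hQ
    _ = KT * (2 * MG * Da + 2 * MG ^ 2) / (m : ℝ) ^ 2 + 2 * KT * MG * Db / m +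
        MG ^ 2 * KT2 * r / (m : ℝ) ^ 3 := by
        field_simp
        ring

end OffDiagonalVariation

section OffDiagonalVariationSum

/-- **The discrete variation of the shift weight, summed** (the discrete `‖V‖_BV ≪ 1`): with the hypotheses of
`abs_shiftWeight_diff_le`, the support cut `f_r(m) = 0` for `m < rθ` (`θ ≥ 2`, `r ≥ 1`) and
`N ≤ X`, `1 ≤ X`:
`|f_r(N−r)| + ∑_{i<N−r−1} |f_r(i+2) − f_r(i+1)| ≤ M_G²K_T/θ + 4K_T(2M_G D_a + 2M_G²)/θ + 8M_G²K_{T²}/θ² + 2K_T M_G D_b (1 + log X)`.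
[cite: BondarenkoHeap2026, §4 p. 12 (proof of Theorem 3: "`‖V‖_BV ≪ 1`")] -/
theorem shiftWeight_variation_le {G : ℕ → ℝ} {MG Da Db KT KT2 : ℝ} {N : ℕ}
    (hG : ∀ n, |G n| ≤ MG) (hΔG : ∀ n, 1 ≤ n → n ≤ N → |G (n + 1) - G n| ≤ Da / n + Db)
    (hDa : 0 ≤ Da) (hDb : 0 ≤ Db) {W : ℝ → ℝ} (hW : ∀ ξ, |W ξ| ≤ KT)
    (hWlip : ∀ ξ ξ', |W ξ - W ξ'| ≤ KT2 * |ξ - ξ'|) (hKT2 : 0 ≤ KT2) {θ : ℝ} (hθ : 2 ≤ θ)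
    {r : ℕ} (hr : 1 ≤ r)
    (hzero : ∀ m : ℕ, 1 ≤ m → (m : ℝ) < r * θ →
      W (Real.log (((m + r : ℕ) : ℝ) / m) / (2 * π)) = 0)
    {X : ℝ} (hX : 1 ≤ X) (hNX : (N : ℝ) ≤ X) :
    |G (N - r) * G (N - r + r) / Real.sqrt (((N - r : ℕ) : ℝ) * (N - r + r : ℕ)) *
        W (Real.log (((N - r + r : ℕ) : ℝ) / (N - r : ℕ)) / (2 * π))| +
      ∑ i ∈ Finset.range (N - r - 1),
        |G (i + 2) * G (i + 2 + r) / Real.sqrt (((i + 2 : ℕ) : ℝ) * (i + 2 + r : ℕ)) *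
            W (Real.log (((i + 2 + r : ℕ) : ℝ) / (i + 2 : ℕ)) / (2 * π)) -
          G (i + 1) * G (i + 1 + r) / Real.sqrt (((i + 1 : ℕ) : ℝ) * (i + 1 + r : ℕ)) *
            W (Real.log (((i + 1 + r : ℕ) : ℝ) / (i + 1 : ℕ)) / (2 * π))| ≤
      MG ^ 2 * KT / θ + 4 * KT * (2 * MG * Da + 2 * MG ^ 2) / θ + 8 * MG ^ 2 * KT2 / θ ^ 2 +
        2 * KT * MG * Db * (1 + Real.log X) := by
  have hMG : 0 ≤ MG := (abs_nonneg _).trans (hG 0)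
  have hKT : 0 ≤ KT := (abs_nonneg _).trans (hW 0)
  have hθ0 : 0 < θ := by linarith
  have hr0 : (1 : ℝ) ≤ r := by exact_mod_cast hr
  have hrθ : 2 ≤ (r : ℝ) * θ := by nlinarith
  -- the weight and its vanishing / size
  set f : ℕ → ℝ := fun m => G m * G (m + r) / Real.sqrt ((m : ℝ) * (m + r : ℕ)) *
    W (Real.log (((m + r : ℕ) : ℝ) / m) / (2 * π)) with hf
  have hf0 : ∀ m : ℕ, (m : ℝ) < r * θ → f m = 0 := by
    intro m hm
    rcases Nat.eq_zero_or_pos m with rfl | hmpos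
    · simp [hf]
    · simp only [hf]; rw [hzero m hmpos hm, mul_zero]
  have hfle : ∀ m : ℕ, 1 ≤ m → |f m| ≤ MG ^ 2 * KT / m := fun m hm =>
    abs_shiftTerm_le hG hW hm r _
  -- Term 0: the last value
  have hT0 : |f (N - r)| ≤ MG ^ 2 * KT / θ := by
    by_cases hlt : ((N - r : ℕ) : ℝ) < r * θ
    · rw [hf0 _ hlt, abs_zero]; positivity
    · push Not at hlt
      have hm1 : 1 ≤ N - r := by
        have : (1 : ℝ) ≤ ((N - r : ℕ) : ℝ) := by linarith
        exact_mod_cast this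
      have hm0 : (0 : ℝ) < ((N - r : ℕ) : ℝ) := by exact_mod_cast hm1
      calc |f (N - r)| ≤ MG ^ 2 * KT / (N - r : ℕ) := hfle _ hm1
        _ ≤ MG ^ 2 * KT / θ := by
            refine div_le_div_of_nonneg_left (by positivity) hθ0 (le_trans ?_ hlt)
            nlinarith
  -- the differences: vanish for `m + 1 < rθ`, else bounded by `abs_shiftWeight_diff_le`
  set a : ℕ := ⌈(r : ℝ) * θ⌉₊ - 1 with ha
  have hceil2 : 2 ≤ ⌈(r : ℝ) * θ⌉₊ := by
    have : 1 < ⌈(r : ℝ) * θ⌉₊ := Nat.lt_ceil.mpr (by push_cast; linarith)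
    omega
  have ha1 : 1 ≤ a := by rw [ha]; omega
  have hcast : (a : ℝ) = (⌈(r : ℝ) * θ⌉₊ : ℝ) - 1 := by
    rw [ha, Nat.cast_sub (by omega)]; simp
  have haR : (r : ℝ) * θ / 2 ≤ a := by
    have hceil : (r : ℝ) * θ ≤ ⌈(r : ℝ) * θ⌉₊ := Nat.le_ceil _
    rw [hcast]; linarith
  have ha0 : (0 : ℝ) < a := by exact_mod_cast ha1
  have hD1 : 0 ≤ 2 * MG * Da + 2 * MG ^ 2 := by positivity
  have hterm : ∀ i ∈ Finset.range (N - r - 1), |f (i + 2) - f (i + 1)| ≤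
      if i + 1 < a then 0 else
        (KT * (2 * MG * Da + 2 * MG ^ 2) / ((i + 1 : ℕ) : ℝ) ^ 2 +
          2 * KT * MG * Db / ((i + 1 : ℕ) : ℝ) + MG ^ 2 * KT2 * r / ((i + 1 : ℕ) : ℝ) ^ 3) := by
    intro i hi
    have hi' := Finset.mem_range.mp hi
    split_ifs with hlt
    · -- both vanish: `i + 2 < rθ`
      have h2 : ((i + 2 : ℕ) : ℝ) < r * θ := by
        have : i + 2 ≤ a := by omega
        have h3 : ((i + 2 : ℕ) : ℝ) ≤ a := by exact_mod_cast this
        have hceil : (a : ℝ) < r * θ := by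
          have := Nat.ceil_lt_add_one (by positivity : (0 : ℝ) ≤ r * θ)
          rw [hcast]; linarith
        linarith
      have h1 : ((i + 1 : ℕ) : ℝ) < r * θ := lt_trans (by push_cast; linarith) h2
      rw [hf0 _ h2, hf0 _ h1, sub_zero, abs_zero]
    · have := abs_shiftWeight_diff_le hG hΔG hDa hDb hW hWlip hKT2 (m := i + 1) (r := r)
        (by omega) (by omega)
      simp only [hf]
      convert this using 3
  -- sum the bounds
  have hsum : ∑ i ∈ Finset.range (N - r - 1), |f (i + 2) - f (i + 1)| ≤
      KT * (2 * MG * Da + 2 * MG ^ 2) * (2 / a) + 2 * KT * MG * Db * (1 + Real.log X) +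
        MG ^ 2 * KT2 * r * (2 / (a : ℝ) ^ 2) := by
    refine (Finset.sum_le_sum hterm).trans ?_
    -- reindex `m = i + 1 ∈ Icc 1 (N - r - 1)` and drop the vanishing terms
    have hre : ∑ i ∈ Finset.range (N - r - 1), (if i + 1 < a then (0 : ℝ) else
        (KT * (2 * MG * Da + 2 * MG ^ 2) / ((i + 1 : ℕ) : ℝ) ^ 2 +
          2 * KT * MG * Db / ((i + 1 : ℕ) : ℝ) + MG ^ 2 * KT2 * r / ((i + 1 : ℕ) : ℝ) ^ 3)) =
        ∑ m ∈ Icc 1 (N - r - 1), (if m < a then (0 : ℝ) else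
          (KT * (2 * MG * Da + 2 * MG ^ 2) / (m : ℝ) ^ 2 + 2 * KT * MG * Db / m +
            MG ^ 2 * KT2 * r / (m : ℝ) ^ 3)) := by
      rw [← Finset.Ico_add_one_right_eq_Icc, Finset.sum_Ico_eq_sum_range]
      simp only [Nat.add_sub_cancel]
      refine Finset.sum_congr rfl fun i _ => ?_
      rw [add_comm 1 i]
    rw [hre]
    have hle : ∀ m ∈ Icc 1 (N - r - 1), (if m < a then (0 : ℝ) else
        (KT * (2 * MG * Da + 2 * MG ^ 2) / (m : ℝ) ^ 2 + 2 * KT * MG * Db / m +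
          MG ^ 2 * KT2 * r / (m : ℝ) ^ 3)) ≤
        (if a ≤ m then KT * (2 * MG * Da + 2 * MG ^ 2) * (1 / (m : ℝ) ^ 2) +
            MG ^ 2 * KT2 * r * (1 / (m : ℝ) ^ 3) else 0) +
          2 * KT * MG * Db * (1 / m) := by
      intro m hm
      have hm1 : (1 : ℝ) ≤ m := by exact_mod_cast (mem_Icc.mp hm).1
      split_ifs with h1 h2
      · positivity
      · positivity
      · apply le_of_eq; ring
      · omega
    refine (Finset.sum_le_sum hle).trans ?_
    rw [Finset.sum_add_distrib, ← Finset.mul_sum, ← Finset.sum_filter]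
    have hfilt : (Icc 1 (N - r - 1)).filter (fun m => a ≤ m) ⊆ Icc a (N - r - 1) := by
      intro m hm
      simp only [mem_filter, mem_Icc] at hm ⊢; omega
    have hS1 : ∑ m ∈ (Icc 1 (N - r - 1)).filter (fun m => a ≤ m),
        (KT * (2 * MG * Da + 2 * MG ^ 2) * (1 / (m : ℝ) ^ 2) + MG ^ 2 * KT2 * r * (1 / (m : ℝ) ^ 3)) ≤
        KT * (2 * MG * Da + 2 * MG ^ 2) * (2 / a) + MG ^ 2 * KT2 * r * (2 / (a : ℝ) ^ 2) := by
      refine (Finset.sum_le_sum_of_subset_of_nonneg hfilt fun m _ _ => by positivity).trans ?_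
      rw [Finset.sum_add_distrib, ← Finset.mul_sum, ← Finset.mul_sum]
      exact add_le_add (mul_le_mul_of_nonneg_left (sum_Icc_inv_sq_le ha1 _) (by positivity))
        (mul_le_mul_of_nonneg_left (sum_Icc_inv_cube_le ha1 _) (by positivity))
    have hS2 : ∑ m ∈ Icc 1 (N - r - 1), 1 / (m : ℝ) ≤ 1 + Real.log X :=
      sum_Icc_inv_le_log hX (le_trans (by exact_mod_cast (by omega : N - r - 1 ≤ N)) hNX)
    have h3 : 2 * KT * MG * Db * ∑ m ∈ Icc 1 (N - r - 1), 1 / (m : ℝ) ≤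
        2 * KT * MG * Db * (1 + Real.log X) := mul_le_mul_of_nonneg_left hS2 (by positivity)
    linarith
  -- `2/a ≤ 4/(rθ) ≤ 4/θ`, `r · 2/a² ≤ 8/(rθ²) ≤ 8/θ²`
  have h2a : 2 / (a : ℝ) ≤ 4 / θ := by
    rw [div_le_div_iff₀ ha0 hθ0]; nlinarith
  have h2a2 : (r : ℝ) * (2 / (a : ℝ) ^ 2) ≤ 8 / θ ^ 2 := by
    rw [mul_div_assoc', div_le_div_iff₀ (by positivity) (by positivity)]
    have h1 : (r : ℝ) * θ ≤ 2 * a := by linarith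
    have h2 : ((r : ℝ) * θ) ^ 2 ≤ (2 * a) ^ 2 := pow_le_pow_left₀ (by positivity) h1 2
    nlinarith
  calc |f (N - r)| + ∑ i ∈ Finset.range (N - r - 1), |f (i + 2) - f (i + 1)|
      ≤ MG ^ 2 * KT / θ + (KT * (2 * MG * Da + 2 * MG ^ 2) * (2 / a) +
          2 * KT * MG * Db * (1 + Real.log X) + MG ^ 2 * KT2 * r * (2 / (a : ℝ) ^ 2)) :=
        add_le_add hT0 hsum
    _ ≤ MG ^ 2 * KT / θ + (KT * (2 * MG * Da + 2 * MG ^ 2) * (4 / θ) +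
          2 * KT * MG * Db * (1 + Real.log X) + MG ^ 2 * KT2 * (8 / θ ^ 2)) := by
        have h1 : KT * (2 * MG * Da + 2 * MG ^ 2) * (2 / a) ≤
            KT * (2 * MG * Da + 2 * MG ^ 2) * (4 / θ) := mul_le_mul_of_nonneg_left h2a (by positivity)
        have h2 : MG ^ 2 * KT2 * r * (2 / (a : ℝ) ^ 2) ≤ MG ^ 2 * KT2 * (8 / θ ^ 2) := by
          rw [mul_assoc (MG ^ 2 * KT2)]
          exact mul_le_mul_of_nonneg_left h2a2 (by positivity)
        linarith
    _ = MG ^ 2 * KT / θ + 4 * KT * (2 * MG * Da + 2 * MG ^ 2) / θ + 8 * MG ^ 2 * KT2 / θ ^ 2 +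
        2 * KT * MG * Db * (1 + Real.log X) := by ring

end OffDiagonalVariationSum

section OffDiagonalAssembly

/-- `√(q g) ≤ √q · g` for `g ≥ 1`. [folklore] -/
private theorem sqrt_mul_le_sqrt_mul_self {q g : ℝ} (hq : 0 ≤ q) (hg : 1 ≤ g) :
    Real.sqrt (q * g) ≤ Real.sqrt q * g := by
  rw [Real.sqrt_mul hq]
  refine mul_le_mul_of_nonneg_left ?_ (Real.sqrt_nonneg q)
  have h1 : 1 ≤ Real.sqrt g := Real.one_le_sqrt.mpr hg
  calc Real.sqrt g ≤ Real.sqrt g * Real.sqrt g := le_mul_of_one_le_right (by linarith) h1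
    _ = g := Real.mul_self_sqrt (by linarith)

/-- `1 + log(q^{17/6}) ≤ 99 q^{1/16}` for `q ≥ 1`. [folklore] -/
private theorem one_add_log_lengthL_le {q : ℝ} (hq : 1 ≤ q) :
    1 + Real.log (q ^ (17 / 6 : ℝ)) ≤ 99 * q ^ (1 / 16 : ℝ) := by
  have hq0 : 0 < q := by linarith
  rw [Real.log_rpow hq0]
  have h1 : 1 + Real.log q ≤ (1 + 2 / (1 / 16)) * q ^ ((1 / 16 : ℝ) / 2) :=
    one_add_log_le_rpow hq (by norm_num)
  have h2 : q ^ ((1 / 16 : ℝ) / 2) ≤ q ^ (1 / 16 : ℝ) :=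
    Real.rpow_le_rpow_of_exponent_le hq (by norm_num)
  have h3 : 0 ≤ Real.log q := Real.log_nonneg hq
  nlinarith [Real.rpow_nonneg hq0.le (1 / 16 : ℝ)]

set_option maxHeartbeats 800000 in
-- one long assembly of explicit inequalities (constants `E₀, E₁, Const`); the default budget is too small
/-- **The off-diagonal estimate in the proof of Theorem 3** (§4 p. 12, last display): for every
`η > 0`, `|offDiagI0| ≤ η S(q)` (`S(q) = Ŵ_T(0)(φ(q)/q) log L`) for all large moduli `q` of primitive
quadratic characters. PROVED along the printed lines — "put `n = m + r`", the support of `Ŵ_T`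
restricts `r ≤ 8πσL/T`, the completion Lemma 4 ((13) + (14)) bounds each shift-`r` character sum by
`q^ε((r,Q)/q · ℓ¹ + √(q(r,Q)) · variation)`, `∑_{r ≤ R}(r,Q) ≤ R d(Q) ≪ R q^ε` ((16)), whence
`offDiag ≪ q^{97/48}` against `S(q) ≫ q^{109/48}` — with one deviation: Lemma 4 is used in its
DISCRETE form `discreteCompletion_of_eq14` (partial summation against the discrete total variation of
the weight `G(m)G(m+r)/√(m(m+r)) Ŵ_T(log(1+r/m)/2π)`, bounded by `exists_G_diff_bound` and the
Lipschitz bound `abs_weightHat_sub_le`), so that no smooth dyadic partition of unity is needed.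
[cite: BondarenkoHeap2026, Theorem 3 (proof, §4 p. 12, "For the off-diagonals … = o(T)")] -/
theorem offDiagI0_le_eventually (w : Bump) (B : ℕ) (ρ : Resonator) (η : ℝ) (hη : 0 < η) :
    ∃ q₀ : ℕ, ∀ (q : ℕ) [NeZero q] (χ : DirichletCharacter ℂ q), q₀ ≤ q → χ.IsPrimitive →
      χ.IsQuadratic → |offDiagI0 w B ρ χ| ≤ η * scaleS w B ρ q := by
  classical
  -- constants depending on `(w, B, ρ)` only
  obtain ⟨MG, hMG0, hMG⟩ := exists_G_bound ρ
  obtain ⟨Da, Db, hDa, hDb, hΔG⟩ := exists_G_diff_bound ρ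
  obtain ⟨K, hK, hKall⟩ := exists_weightHat_bounds w B
  obtain ⟨C, hC, hDC⟩ := discreteCompletion_of_eq14 eq14_holds (ε := 1 / 16) (by norm_num)
  obtain ⟨Cd, hCd1, hCd⟩ :=
    Literature.NumberTheory.Sieve.exists_card_divisors_le_mul_rpow (ε := 1 / 16) (by norm_num)
  obtain ⟨Cφ, hCφ, hφ⟩ := exists_self_div_totient_le_rpow (ε := 1 / 16) (by norm_num)
  obtain ⟨q₁, hq₁⟩ := weightHat_zero_lower cPhi_pos_holds weightHat_zero_holds w B ρ
  have hcΦ : 0 < cPhi w B := cPhi_pos_holds w B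
  have hσ : 0 < w.σ := w.σ_pos
  set σ : ℝ := w.σ with hσdef
  set E0 : ℝ := 8 * π * σ * MG ^ 2 * K + 32 * π * σ * K * (2 * MG * Da + 2 * MG ^ 2) +
    512 * π ^ 2 * σ ^ 2 * MG ^ 2 * K with hE0
  set E1 : ℝ := 2 * K * MG * Db with hE1
  have hE00 : 0 ≤ E0 := by positivity
  have hE10 : 0 ≤ E1 := by positivity
  set Const : ℝ := 16 * π * σ * C * Cd * (99 * MG ^ 2 * K + E0 + 99 * E1) with hConst
  have hConst0 : 0 ≤ Const := by positivity
  -- `q` large enough for the final comparison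
  obtain ⟨q₂, hq₂⟩ : ∃ q₂ : ℕ, ∀ q : ℕ, q₂ ≤ q →
      2 * Cφ * Const / (η * cPhi w B) ≤ (q : ℝ) ^ (1 / 4 : ℝ) := by
    have ht := (tendsto_rpow_atTop (by norm_num : (0 : ℝ) < 1 / 4)).comp
      tendsto_natCast_atTop_atTop
    obtain ⟨q₂, h⟩ := Filter.eventually_atTop.mp (ht.eventually_ge_atTop (2 * Cφ * Const / (η * cPhi w B)))
    exact ⟨q₂, fun q hq => h q hq⟩
  set q₃ : ℕ := ⌈16 * π * σ + 4 * π * σ / Real.log 2⌉₊ + 1 with hq₃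
  refine ⟨max (max q₁ q₂) (max 3 q₃), ?_⟩
  intro q _ χ hq hχp hχq
  have hq1' : q₁ ≤ q := le_trans (le_trans (le_max_left _ _) (le_max_left _ _)) hq
  have hq2' : q₂ ≤ q := le_trans (le_trans (le_max_right _ _) (le_max_left _ _)) hq
  have hq3 : 3 ≤ q := le_trans (le_trans (le_max_left _ _) (le_max_right _ _)) hq
  have hq3' : q₃ ≤ q := le_trans (le_trans (le_max_right _ _) (le_max_right _ _)) hq
  obtain ⟨ν, Q, hqQ, hν, hQodd, hQsf⟩ := modulus_eq_two_pow_mul_odd_squarefree hχp hχq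
  have hQ0 : Q ≠ 0 := by rintro rfl; exact (Nat.not_odd_zero hQodd).elim
  have hQq : (Q : ℝ) ≤ q := by
    have : Q ≤ q := by rw [hqQ]; exact Nat.le_mul_of_pos_left Q (Nat.one_le_two_pow)
    exact_mod_cast this
  -- basic quantities
  have hq0 : (0 : ℝ) < q := by exact_mod_cast lt_of_lt_of_le (by norm_num) hq3
  have hq1 : (1 : ℝ) ≤ q := by exact_mod_cast le_trans (by norm_num) hq3
  have hq3r : (3 : ℝ) ≤ q := by exact_mod_cast hq3
  set T : ℝ := ρ.T q with hTdef
  set L : ℝ := lengthL q with hLdef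
  set N : ℕ := ⌊L⌋₊ with hNdef
  have hqT : (q : ℝ) ≤ T := le_T ρ (by omega)
  have hT1 : 1 ≤ T := le_trans hq1 hqT
  have hT0 : 0 < T := by linarith
  have hLq : (q : ℝ) ≤ L := by
    rw [hLdef, lengthL]
    calc (q : ℝ) = (q : ℝ) ^ (1 : ℝ) := (Real.rpow_one _).symm
      _ ≤ (q : ℝ) ^ (17 / 6 : ℝ) := Real.rpow_le_rpow_of_exponent_le hq1 (by norm_num)
  have hL3 : 3 ≤ L := le_trans hq3r hLq
  have hL1 : 1 ≤ L := by linarith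
  have hL0 : 0 < L := by linarith
  have hNL : (N : ℝ) ≤ L := Nat.floor_le hL0.le
  have hTq73 : (q : ℝ) ^ (7 / 3 : ℝ) ≤ T := by
    rw [hTdef, Resonator.T]
    exact Real.rpow_le_rpow_of_exponent_le hq1 (by linarith [ρ.δ_pos])
  have hTL : T ≤ L := by
    rw [hTdef, Resonator.T, hLdef, lengthL]
    exact Real.rpow_le_rpow_of_exponent_le hq1 (by linarith [ρ.δ_lt])
  have hLT : L / T ≤ (q : ℝ) ^ (1 / 2 : ℝ) := by
    rw [div_le_iff₀ hT0]
    calc L = (q : ℝ) ^ (17 / 6 : ℝ) := rfl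
      _ = (q : ℝ) ^ (1 / 2 : ℝ) * (q : ℝ) ^ (7 / 3 : ℝ) := by
          rw [← Real.rpow_add hq0]; norm_num
      _ ≤ (q : ℝ) ^ (1 / 2 : ℝ) * T := mul_le_mul_of_nonneg_left hTq73 (by positivity)
  -- `T` large
  have hq₃r : 16 * π * σ + 4 * π * σ / Real.log 2 < q := by
    have h1 : 16 * π * σ + 4 * π * σ / Real.log 2 ≤ ⌈16 * π * σ + 4 * π * σ / Real.log 2⌉₊ :=
      Nat.le_ceil _
    have h2 : ((⌈16 * π * σ + 4 * π * σ / Real.log 2⌉₊ + 1 : ℕ) : ℝ) ≤ q := by exact_mod_cast hq3'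
    push_cast at h2; linarith
  have hlog2 : 0 < Real.log 2 := Real.log_pos one_lt_two
  have hT4 : 4 * π * σ / Real.log 2 < T := by
    have : 0 ≤ 16 * π * σ := by positivity
    linarith
  have hT16 : 16 * π * σ ≤ T := by
    have : 0 ≤ 4 * π * σ / Real.log 2 := by positivity
    linarith
  set θ : ℝ := T / (8 * π * σ) with hθ
  have h8 : 0 < 8 * π * σ := by positivity
  have hθ2 : 2 ≤ θ := by rw [hθ, le_div_iff₀ h8]; linarith
  have hθ0 : 0 < θ := by linarith
  -- the weight facts at this `T`
  obtain ⟨hWsup, hWlip, hWzero⟩ := hKall T hT1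
  set W : ℝ → ℝ := weightHat w B T with hWdef
  set G : ℕ → ℝ := ρ.G q with hGdef
  have hGb : ∀ n, |G n| ≤ MG := fun n => hMG q n (by omega)
  have hΔG' : ∀ n, 1 ≤ n → n ≤ N → |G (n + 1) - G n| ≤ Da / n + Db / L :=
    fun n hn hnN => hΔG q hL3 n hn (le_trans (by exact_mod_cast hnN) hNL)
  have hKT2 : 0 ≤ K * T ^ 2 := by positivity
  have hzero : ∀ r m : ℕ, 1 ≤ m → (m : ℝ) < r * θ →
      W (Real.log (((m + r : ℕ) : ℝ) / m) / (2 * π)) = 0 := by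
    intro r m hm hlt
    refine weightHat_shift_eq_zero hσ hWzero hT4 hm ?_
    rw [hθ, mul_div_assoc', lt_div_iff₀ h8] at hlt
    linarith
  -- the shift weight for a given `r`
  set f : ℕ → ℕ → ℝ := fun r m => G m * G (m + r) / Real.sqrt ((m : ℝ) * (m + r : ℕ)) *
    W (Real.log (((m + r : ℕ) : ℝ) / m) / (2 * π)) with hf
  -- Y := the common factor of the per-`r` bound
  set Y : ℝ := MG ^ 2 * K * T * (1 + Real.log L) / q +
    Real.sqrt q * (E0 + E1 * T * (1 + Real.log L) / L) with hY
  have hlogL0 : 0 ≤ Real.log L := Real.log_nonneg hL1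
  have hY0 : 0 ≤ Y := by positivity
  set R₀ : ℕ := ⌊8 * π * σ * L / T⌋₊ with hR₀
  have hR₀le : (R₀ : ℝ) ≤ 8 * π * σ * L / T := Nat.floor_le (by positivity)
  -- per-`r` bound
  have hSr : ∀ r ∈ Icc 1 N, |∑ m ∈ Icc 1 (N - r),
      ρ.coeff χ m * ρ.coeff χ (m + r) / Real.sqrt ((m : ℝ) * (m + r : ℕ)) *
        weightHat w B (ρ.T q) (Real.log (((m + r : ℕ) : ℝ) / m) / (2 * π))| ≤
      if r ≤ R₀ then C * (q : ℝ) ^ (1 / 16 : ℝ) * (Nat.gcd r Q : ℝ) * Y else 0 := by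
    intro r hr
    have hr1 : 1 ≤ r := (mem_Icc.mp hr).1
    split_ifs with hrR
    · -- rewrite as the real part of a character sum against `f r`
      have hre : ∑ m ∈ Icc 1 (N - r),
          ρ.coeff χ m * ρ.coeff χ (m + r) / Real.sqrt ((m : ℝ) * (m + r : ℕ)) *
            weightHat w B (ρ.T q) (Real.log (((m + r : ℕ) : ℝ) / m) / (2 * π)) =
          ∑ m ∈ Icc 1 (N - r), ρ.coeff χ m * ρ.coeff χ (m + r) *
            (1 / Real.sqrt ((m : ℝ) * (m + r : ℕ)) *
              W (Real.log (((m + r : ℕ) : ℝ) / m) / (2 * π))) := by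
        refine sum_congr rfl fun m _ => ?_; rw [hWdef, hTdef]; ring
      rw [hre, sum_coeff_shift_eq_re hχq]
      have hfun : ∀ m : ℕ, ρ.G q m * ρ.G q (m + r) *
          (1 / Real.sqrt ((m : ℝ) * (m + r : ℕ)) * W (Real.log (((m + r : ℕ) : ℝ) / m) / (2 * π))) =
          f r m := by intro m; simp only [hf, hGdef]; ring
      simp_rw [hfun]
      refine (Complex.abs_re_le_norm _).trans ?_
      have hmain := hDC q χ hχp hχq ν Q hqQ hQodd 1 r one_ne_zero (by exact_mod_cast (by omega : r ≠ 0))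
        (N - r) (fun m => ((f r m : ℝ) : ℂ))
      refine hmain.trans ?_
      -- norms of real numbers
      have hn1 : ∀ m, ‖((f r m : ℝ) : ℂ)‖ = |f r m| := fun m => by
        rw [Complex.norm_real, Real.norm_eq_abs]
      have hn2 : ∀ a b : ℕ, ‖((f r a : ℝ) : ℂ) - ((f r b : ℝ) : ℂ)‖ = |f r a - f r b| := fun a b => by
        rw [← Complex.ofReal_sub, Complex.norm_real, Real.norm_eq_abs]
      simp only [hn1, hn2]
      rw [Int.gcd_natCast_natCast]
      set g : ℕ := Nat.gcd r Q with hg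
      have hg1 : (1 : ℝ) ≤ g := by exact_mod_cast Nat.gcd_pos_of_pos_right r (Nat.pos_of_ne_zero hQ0)
      -- ℓ¹ bound
      have hl1 : ∑ m ∈ Icc 1 (N - r), |f r m| ≤ MG ^ 2 * K * T * (1 + Real.log L) := by
        calc ∑ m ∈ Icc 1 (N - r), |f r m| ≤ ∑ m ∈ Icc 1 (N - r), MG ^ 2 * (K * T) * (1 / (m : ℝ)) := by
              refine sum_le_sum fun m hm => ?_
              have hm1 : 1 ≤ m := (mem_Icc.mp hm).1
              have := abs_shiftTerm_le hGb hWsup hm1 r (Real.log (((m + r : ℕ) : ℝ) / m) / (2 * π))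
              simp only [hf]
              calc _ ≤ MG ^ 2 * (K * T) / m := this
                _ = MG ^ 2 * (K * T) * (1 / (m : ℝ)) := by ring
          _ = MG ^ 2 * (K * T) * ∑ m ∈ Icc 1 (N - r), 1 / (m : ℝ) := by rw [mul_sum]
          _ ≤ MG ^ 2 * (K * T) * (1 + Real.log L) :=
              mul_le_mul_of_nonneg_left (sum_Icc_inv_le_log hL1
                (le_trans (by exact_mod_cast (by omega : N - r ≤ N)) hNL)) (by positivity)
          _ = MG ^ 2 * K * T * (1 + Real.log L) := by ring
      -- variation bound
      have hvar := shiftWeight_variation_le (N := N) hGb hΔG' hDa (by positivity) hWsup hWlip hKT2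
        hθ2 hr1 (hzero r) hL1 hNL
      have hNr : N - r + r = N - r + r := rfl
      have hvar' : |f r (N - r)| + ∑ i ∈ Finset.range (N - r - 1), |f r (i + 2) - f r (i + 1)| ≤
          E0 + E1 * T * (1 + Real.log L) / L := by
        simp only [hf]
        refine hvar.trans (le_of_eq ?_)
        rw [hE0, hE1, hθ]
        field_simp
        ring
      have hsq : Real.sqrt (q * g) ≤ Real.sqrt q * g := sqrt_mul_le_sqrt_mul_self hq0.le hg1
      have hqε : 0 ≤ C * (q : ℝ) ^ (1 / 16 : ℝ) := by positivity
      calc C * (q : ℝ) ^ (1 / 16 : ℝ) * ((g : ℝ) / q * ∑ m ∈ Icc 1 (N - r), |f r m| +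
            Real.sqrt (q * g) * (|f r (N - r)| +
              ∑ i ∈ Finset.range (N - r - 1), |f r (i + 2) - f r (i + 1)|))
          ≤ C * (q : ℝ) ^ (1 / 16 : ℝ) * ((g : ℝ) / q * (MG ^ 2 * K * T * (1 + Real.log L)) +
            (Real.sqrt q * g) * (E0 + E1 * T * (1 + Real.log L) / L)) := by
            refine mul_le_mul_of_nonneg_left (add_le_add ?_ ?_) hqε
            · exact mul_le_mul_of_nonneg_left hl1 (by positivity)
            · exact mul_le_mul hsq hvar' (by positivity) (by positivity)
        _ = C * (q : ℝ) ^ (1 / 16 : ℝ) * g * Y := by rw [hY]; ring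
    · -- `r > R₀`: every term vanishes
      push Not at hrR
      refine le_of_eq ?_
      rw [abs_eq_zero]
      refine sum_eq_zero fun m hm => ?_
      have hm1 : 1 ≤ m := (mem_Icc.mp hm).1
      have hmN : m ≤ N - r := (mem_Icc.mp hm).2
      have hlt : (m : ℝ) < r * θ := by
        have hmL : (m : ℝ) ≤ L := le_trans (by exact_mod_cast (le_trans hmN (Nat.sub_le N r))) hNL
        have hrgt : 8 * π * σ * L / T < r := by
          have := Nat.lt_floor_add_one (8 * π * σ * L / T)
          have h2 : ((R₀ + 1 : ℕ) : ℝ) ≤ r := by exact_mod_cast hrR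
          push_cast at h2
          rw [hR₀] at h2
          linarith
        have hkey : (8 * π * σ * L / T) * θ = L := by
          rw [hθ]; field_simp
        have h3 := mul_lt_mul_of_pos_right hrgt hθ0
        rw [hkey] at h3
        linarith
      have := hzero r m hm1 hlt
      rw [hWdef, hTdef] at this
      rw [this, mul_zero]
  -- sum over `r`
  have hsumr : |∑ r ∈ Icc 1 N, ∑ m ∈ Icc 1 (N - r),
      ρ.coeff χ m * ρ.coeff χ (m + r) / Real.sqrt ((m : ℝ) * (m + r : ℕ)) *
        weightHat w B (ρ.T q) (Real.log (((m + r : ℕ) : ℝ) / m) / (2 * π))| ≤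
      C * (q : ℝ) ^ (1 / 16 : ℝ) * Y * (R₀ * (Q.divisors.card : ℝ)) := by
    refine (abs_sum_le_sum_abs _ _).trans ((sum_le_sum hSr).trans ?_)
    rw [← sum_filter]
    have hsub : (Icc 1 N).filter (fun r => r ≤ R₀) ⊆ Ioc 0 R₀ := by
      intro r hr; simp only [mem_filter, mem_Icc, mem_Ioc] at hr ⊢; omega
    calc ∑ r ∈ (Icc 1 N).filter (fun r => r ≤ R₀), C * (q : ℝ) ^ (1 / 16 : ℝ) * (Nat.gcd r Q : ℝ) * Y
        ≤ ∑ r ∈ Ioc 0 R₀, C * (q : ℝ) ^ (1 / 16 : ℝ) * (Nat.gcd r Q : ℝ) * Y :=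
          sum_le_sum_of_subset_of_nonneg hsub fun r _ _ => by positivity
      _ = C * (q : ℝ) ^ (1 / 16 : ℝ) * Y * ∑ r ∈ Ioc 0 R₀, (Nat.gcd r Q : ℝ) := by
          rw [mul_sum]; exact sum_congr rfl fun r _ => by ring
      _ ≤ C * (q : ℝ) ^ (1 / 16 : ℝ) * Y * (R₀ * (Q.divisors.card : ℝ)) :=
          mul_le_mul_of_nonneg_left (gcd_sum_le hQ0 R₀) (by positivity)
  -- numerical bounds
  have hlogL : 1 + Real.log L ≤ 99 * (q : ℝ) ^ (1 / 16 : ℝ) := one_add_log_lengthL_le hq1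
  have hdQ : (Q.divisors.card : ℝ) ≤ Cd * (q : ℝ) ^ (1 / 16 : ℝ) :=
    (hCd Q hQ0).trans (mul_le_mul_of_nonneg_left
      (Real.rpow_le_rpow (Nat.cast_nonneg Q) hQq (by norm_num)) (by linarith))
  have hq16 : 0 < (q : ℝ) ^ (1 / 16 : ℝ) := by positivity
  -- `Y ≤ 99 MG²K T q^{1/16}/q + √q E0 + 99 E1 q`
  have hsqrtq : Real.sqrt q * (q : ℝ) ^ (1 / 16 : ℝ) ≤ q := by
    rw [Real.sqrt_eq_rpow, ← Real.rpow_add hq0]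
    calc (q : ℝ) ^ ((1 / 2 : ℝ) + 1 / 16) ≤ (q : ℝ) ^ (1 : ℝ) :=
        Real.rpow_le_rpow_of_exponent_le hq1 (by norm_num)
      _ = q := Real.rpow_one _
  have hYle : Y ≤ 99 * MG ^ 2 * K * (T * (q : ℝ) ^ (1 / 16 : ℝ) / q) + Real.sqrt q * E0 +
      99 * E1 * q := by
    have h1 : MG ^ 2 * K * T * (1 + Real.log L) / q ≤ 99 * MG ^ 2 * K * (T * (q : ℝ) ^ (1 / 16 : ℝ) / q) := by
      have : MG ^ 2 * K * T * (1 + Real.log L) / q = MG ^ 2 * K * (T * (1 + Real.log L) / q) := by ring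
      rw [this]
      have h2 : T * (1 + Real.log L) / q ≤ T * (99 * (q : ℝ) ^ (1 / 16 : ℝ)) / q := by
        gcongr
      calc MG ^ 2 * K * (T * (1 + Real.log L) / q) ≤ MG ^ 2 * K * (T * (99 * (q : ℝ) ^ (1 / 16 : ℝ)) / q) :=
          mul_le_mul_of_nonneg_left h2 (by positivity)
        _ = 99 * MG ^ 2 * K * (T * (q : ℝ) ^ (1 / 16 : ℝ) / q) := by ring
    have h3 : Real.sqrt q * (E1 * T * (1 + Real.log L) / L) ≤ 99 * E1 * q := by
      have hTL' : T / L ≤ 1 := (div_le_one hL0).mpr hTL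
      calc Real.sqrt q * (E1 * T * (1 + Real.log L) / L)
          = E1 * (T / L) * (Real.sqrt q * (1 + Real.log L)) := by ring
        _ ≤ E1 * 1 * (Real.sqrt q * (99 * (q : ℝ) ^ (1 / 16 : ℝ))) := by
            gcongr
        _ = 99 * E1 * (Real.sqrt q * (q : ℝ) ^ (1 / 16 : ℝ)) := by ring
        _ ≤ 99 * E1 * q := mul_le_mul_of_nonneg_left hsqrtq (by positivity)
    calc Y = MG ^ 2 * K * T * (1 + Real.log L) / q +
        (Real.sqrt q * E0 + Real.sqrt q * (E1 * T * (1 + Real.log L) / L)) := by rw [hY]; ring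
      _ ≤ _ := by linarith
  -- the total bound `≤ Const · q^{97/48}`
  have hpow1 : L * (T * (q : ℝ) ^ (1 / 16 : ℝ) / q) / T = (q : ℝ) ^ (91 / 48 : ℝ) := by
    rw [show L * (T * (q : ℝ) ^ (1 / 16 : ℝ) / q) / T = L * (q : ℝ) ^ (1 / 16 : ℝ) / q by
      field_simp]
    rw [hLdef, lengthL, ← Real.rpow_add hq0, div_eq_iff hq0.ne', ← Real.rpow_add_one hq0.ne']
    norm_num
  have hpow2 : L / T * (Real.sqrt q) ≤ (q : ℝ) ^ (91 / 48 : ℝ) := by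
    calc L / T * Real.sqrt q ≤ (q : ℝ) ^ (1 / 2 : ℝ) * Real.sqrt q :=
          mul_le_mul_of_nonneg_right hLT (Real.sqrt_nonneg _)
      _ = (q : ℝ) ^ (1 : ℝ) := by rw [Real.sqrt_eq_rpow, ← Real.rpow_add hq0]; norm_num
      _ ≤ (q : ℝ) ^ (91 / 48 : ℝ) := Real.rpow_le_rpow_of_exponent_le hq1 (by norm_num)
  have hpow3 : L / T * q ≤ (q : ℝ) ^ (91 / 48 : ℝ) := by
    calc L / T * q ≤ (q : ℝ) ^ (1 / 2 : ℝ) * q := mul_le_mul_of_nonneg_right hLT hq0.le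
      _ = (q : ℝ) ^ (3 / 2 : ℝ) := by
          conv_lhs => rw [show (q : ℝ) ^ (1 / 2 : ℝ) * q = (q : ℝ) ^ (1 / 2 : ℝ) * (q : ℝ) ^ (1 : ℝ) by
            rw [Real.rpow_one]]
          rw [← Real.rpow_add hq0]; norm_num
      _ ≤ (q : ℝ) ^ (91 / 48 : ℝ) := Real.rpow_le_rpow_of_exponent_le hq1 (by norm_num)
  have hq91 : 0 ≤ (q : ℝ) ^ (91 / 48 : ℝ) := by positivity
  have htotal : 2 * (C * (q : ℝ) ^ (1 / 16 : ℝ) * Y * (R₀ * (Q.divisors.card : ℝ))) ≤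
      Const * (q : ℝ) ^ (97 / 48 : ℝ) := by
    -- `R₀ d(Q) ≤ (8πσ L/T) Cd q^{1/16}` and `Y (L/T) ≤ (99MG²K + E0 + 99E1) q^{91/48}`
    have h1 : (R₀ : ℝ) * (Q.divisors.card : ℝ) ≤ (8 * π * σ * L / T) * (Cd * (q : ℝ) ^ (1 / 16 : ℝ)) :=
      mul_le_mul hR₀le hdQ (by positivity) (by positivity)
    have h2 : Y * (L / T) ≤ (99 * MG ^ 2 * K + E0 + 99 * E1) * (q : ℝ) ^ (91 / 48 : ℝ) := by
      have hLT0 : 0 ≤ L / T := by positivity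
      calc Y * (L / T) ≤ (99 * MG ^ 2 * K * (T * (q : ℝ) ^ (1 / 16 : ℝ) / q) + Real.sqrt q * E0 +
            99 * E1 * q) * (L / T) := mul_le_mul_of_nonneg_right hYle hLT0
        _ = 99 * MG ^ 2 * K * (L * (T * (q : ℝ) ^ (1 / 16 : ℝ) / q) / T) +
            E0 * (L / T * Real.sqrt q) + 99 * E1 * (L / T * q) := by ring
        _ ≤ 99 * MG ^ 2 * K * (q : ℝ) ^ (91 / 48 : ℝ) + E0 * (q : ℝ) ^ (91 / 48 : ℝ) +
            99 * E1 * (q : ℝ) ^ (91 / 48 : ℝ) := by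
            rw [hpow1]
            have ha := mul_le_mul_of_nonneg_left hpow2 hE00
            have hb := mul_le_mul_of_nonneg_left hpow3 (by positivity : (0 : ℝ) ≤ 99 * E1)
            linarith
        _ = (99 * MG ^ 2 * K + E0 + 99 * E1) * (q : ℝ) ^ (91 / 48 : ℝ) := by ring
    have h3 : (q : ℝ) ^ (1 / 16 : ℝ) * (q : ℝ) ^ (1 / 16 : ℝ) * (q : ℝ) ^ (91 / 48 : ℝ) =
        (q : ℝ) ^ (97 / 48 : ℝ) := by
      rw [← Real.rpow_add hq0, ← Real.rpow_add hq0]; norm_num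
    calc 2 * (C * (q : ℝ) ^ (1 / 16 : ℝ) * Y * (R₀ * (Q.divisors.card : ℝ)))
        ≤ 2 * (C * (q : ℝ) ^ (1 / 16 : ℝ) * Y * ((8 * π * σ * L / T) * (Cd * (q : ℝ) ^ (1 / 16 : ℝ)))) := by
          have : 0 ≤ C * (q : ℝ) ^ (1 / 16 : ℝ) * Y := by positivity
          have h4 := mul_le_mul_of_nonneg_left h1 this
          linarith
      _ = 16 * π * σ * C * Cd * ((q : ℝ) ^ (1 / 16 : ℝ) * (q : ℝ) ^ (1 / 16 : ℝ)) * (Y * (L / T)) := by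
          ring
      _ ≤ 16 * π * σ * C * Cd * ((q : ℝ) ^ (1 / 16 : ℝ) * (q : ℝ) ^ (1 / 16 : ℝ)) *
          ((99 * MG ^ 2 * K + E0 + 99 * E1) * (q : ℝ) ^ (91 / 48 : ℝ)) :=
          mul_le_mul_of_nonneg_left h2 (by positivity)
      _ = Const * (q : ℝ) ^ (97 / 48 : ℝ) := by rw [hConst, ← h3]; ring
  -- the lower bound for `η S(q)`
  have hW0 : cPhi w B * T / 2 ≤ weightHat w B (ρ.T q) 0 := hq₁ q hq1'
  have hφq : (q : ℝ) / Nat.totient q ≤ Cφ * (q : ℝ) ^ (1 / 16 : ℝ) := hφ q (by omega)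
  have hφpos : (0 : ℝ) < Nat.totient q := by exact_mod_cast Nat.totient_pos.mpr (by omega)
  have hφlow : 1 / (Cφ * (q : ℝ) ^ (1 / 16 : ℝ)) ≤ (Nat.totient q : ℝ) / q := by
    rw [div_le_div_iff₀ (by positivity) hq0, one_mul]
    rw [div_le_iff₀ hφpos] at hφq
    linarith
  have hlogL1 : 1 ≤ Real.log L := by
    rw [← Real.log_exp 1]
    refine Real.log_le_log (Real.exp_pos 1) (le_trans ?_ hL3)
    have := Real.exp_one_lt_d9; norm_num at this ⊢; linarith
  have hS : η * (cPhi w B / (2 * Cφ)) * (q : ℝ) ^ (109 / 48 : ℝ) ≤ η * scaleS w B ρ q := by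
    rw [scaleS]
    have h1 : (q : ℝ) ^ (109 / 48 : ℝ) = (q : ℝ) ^ (7 / 3 : ℝ) * (1 / (q : ℝ) ^ (1 / 16 : ℝ)) := by
      rw [one_div, ← Real.rpow_neg hq0.le, ← Real.rpow_add hq0]; norm_num
    have h2 : η * (cPhi w B / (2 * Cφ)) * (q : ℝ) ^ (109 / 48 : ℝ) =
        η * ((cPhi w B * (q : ℝ) ^ (7 / 3 : ℝ) / 2) * (1 / (Cφ * (q : ℝ) ^ (1 / 16 : ℝ))) * 1) := by
      rw [h1]; field_simp
    rw [h2]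
    refine mul_le_mul_of_nonneg_left ?_ hη.le
    refine mul_le_mul (mul_le_mul ?_ hφlow (by positivity) ?_) hlogL1 zero_le_one ?_
    · calc cPhi w B * (q : ℝ) ^ (7 / 3 : ℝ) / 2 ≤ cPhi w B * T / 2 := by gcongr
        _ ≤ weightHat w B (ρ.T q) 0 := hW0
    · linarith [hW0, (by positivity : 0 ≤ cPhi w B * T / 2)]
    · exact mul_nonneg (by linarith [hW0, (by positivity : 0 ≤ cPhi w B * T / 2)])
        (by positivity)
  -- compare: `Const q^{97/48} ≤ η cΦ/(2Cφ) q^{109/48}` since `q^{1/4} ≥ 2 Cφ Const/(η cΦ)`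
  have hfinal : Const * (q : ℝ) ^ (97 / 48 : ℝ) ≤ η * (cPhi w B / (2 * Cφ)) * (q : ℝ) ^ (109 / 48 : ℝ) := by
    have hq4 := hq₂ q hq2'
    have h1 : (q : ℝ) ^ (109 / 48 : ℝ) = (q : ℝ) ^ (1 / 4 : ℝ) * (q : ℝ) ^ (97 / 48 : ℝ) := by
      rw [← Real.rpow_add hq0]; norm_num
    rw [h1, ← mul_assoc]
    refine mul_le_mul_of_nonneg_right ?_ (by positivity)
    rw [div_le_iff₀ (by positivity)] at hq4
    have : η * (cPhi w B / (2 * Cφ)) * (q : ℝ) ^ (1 / 4 : ℝ) =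
        (q : ℝ) ^ (1 / 4 : ℝ) * (η * cPhi w B) / (2 * Cφ) := by ring
    rw [this, le_div_iff₀ (by positivity)]
    linarith
  rw [offDiagI0_eq_shift, ← hLdef, ← hNdef, abs_mul, abs_two]
  calc 2 * |∑ r ∈ Icc 1 N, ∑ m ∈ Icc 1 (N - r),
        ρ.coeff χ m * ρ.coeff χ (m + r) / Real.sqrt ((m : ℝ) * (m + r : ℕ)) *
          weightHat w B (ρ.T q) (Real.log (((m + r : ℕ) : ℝ) / m) / (2 * π))|
      ≤ 2 * (C * (q : ℝ) ^ (1 / 16 : ℝ) * Y * (R₀ * (Q.divisors.card : ℝ))) := by linarith [hsumr]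
    _ ≤ Const * (q : ℝ) ^ (97 / 48 : ℝ) := htotal
    _ ≤ η * (cPhi w B / (2 * Cφ)) * (q : ℝ) ^ (109 / 48 : ℝ) := hfinal
    _ ≤ η * scaleS w B ρ q := hS

/-- **Bondarenko–Heap Theorem 3 — PROVED**: `I₀ = (1 + o(1)) D_G Ŵ_T(0)(φ(q)/q) log L` along moduli
of primitive quadratic characters, by t2's reduction `theorem3_of_offDiagonal` ((15), the diagonal
and (3) being kernel theorems) and the off-diagonal estimate `offDiagI0_le_eventually`.
[cite: BondarenkoHeap2026, Theorem 3 (§2.3 (6) p. 8; proof §4 pp. 11–12)] -/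
theorem theorem3_holds : theorem3 :=
  theorem3_of_offDiagonal fun w B ρ η hη => offDiagI0_le_eventually w B ρ η hη

/-- Bookkeeping corollary: Theorem 1 from Proposition 1 (RH-conditional), Proposition 3 and
Proposition 6 — the Thm3-offdiag binder of `bondarenkoHeap2026_theorem1_of_leaves` is discharged.
NOT RH-BEARING: an implication between printed claims. [claim: BondarenkoHeap2026, status: under-review] -/
theorem bondarenkoHeap2026_theorem1_of_prop1_prop3_prop6 (h1 : proposition1) (h3 : prop3)
    (h6 : prop6) : bondarenkoHeap2026_theorem1 :=
  bondarenkoHeap2026_theorem1_of_leaves h1 (fun w B ρ η hη => offDiagI0_le_eventually w B ρ η hη)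
    h3 h6

end OffDiagonalAssembly

end Literature.NumberTheory.LFunctions.BondarenkoHeap2026
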